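import Literature.NumberTheory.Sieve.HeathBrownCubicTypeIProofs
import Literature.NumberTheory.Sieve.LargeSieveCharacters
import HarnessLib

/-!
# Heath-Brown's Lemma 5.1 (the Type I estimate without coprimality) from Lemma 4.7 (pp. 28–30)

Pure-proof file (no definitions, no named facts) in the decomposition of **parity.S18** along
D. R. Heath-Brown, *Primes represented by `x³ + 2y³`*, Acta Math. 186 (2001), 1–84. The Type I bound
**Lemma 3.2** (`HeathBrown2001_typeI_A`, `HeathBrownCubicSieveSetup`) was reduced in
`HeathBrownCubicTypeIProofs` (`HeathBrown2001_typeI_A_of_bounds`) to the statements of **Lemma 4.7**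
(divisor sums of `τ(m + n·2^{1/3})^A` over boxes) and **Lemma 5.1** (p. 28): for
`S(R; X) = #{x, y ∈ (X, X(1+η)] : R ∣ x + y·2^{1/3}}` (`latticeCount`),
`∑_{Q<N(R)≤2Q, R∈𝒯r} τ(R)^A |S(R; X) − η²X²/N(R)| ≪ (X + Q)(log Q)^{c(A)}`. This file PROVES Lemma 5.1
from the statement of Lemma 4.7 (`lemma_5_1_bound_of_lemma_4_7_bound`), following pp. 28–30, and
concludes **`HeathBrown2001_typeI_A_of_lemma_4_7`: Lemma 3.2 follows from Lemma 4.7 alone.**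

## The argument (pp. 28–30) and its formalisation

* `𝓞_K/R ≅ ℤ/N(R)` for `R ∈ 𝒯r` (square-free norm): `2^{1/3} ≡ n_R (mod R)` for a rational integer
  `n_R` (`exists_int_θint_sub_mem_of_squarefree`; first-degree primes `(p, n − 2^{1/3})`, p. 21, and the
  Chinese remainder theorem), `R ∩ ℤ = (N(R))` (`intCast_mem_iff_absNorm_dvd`), hence
  `R ∣ x + y·2^{1/3} ⟺ N(R) ∣ x + y n_R` (`dvd_pairIdeal_iff_absNorm_dvd`) — the paper's "the number of
  pairs `u, v` modulo `N(R)` for which `R ∣ u + v·2^{1/3}` will be `N(R)`" (p. 29), and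
  `R ∣ b − a·2^{1/3} ⟺ N(R) ∣ b − a n_R` (`dvd_span_sub_mul_θint_iff`), the criterion of p. 30.
* Additive characters (with the tree's `LargeSieve.e`, `e(t) = exp(2πit)`): orthogonality modulo `N`
  (`sum_range_e_mul_div_eq_ite_dvd`), the count on the line `x + ny ≡ 0`,
  `#{(x,y) : N ∣ x + ny} = N⁻¹ ∑_{a<N} F(a) F(an)` with `F(a) = ∑_x e(ax/N)` (`card_filter_dvd_eq_sum`),
  the geometric sums `|F(a)| ≤ min(L, N/min(a, N−a))` (`norm_sum_Ioc_e_le_div_min`, from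
  `LargeSieve.norm_sum_Ioc_e_le`, `LargeSieve.inv_norm_e_sub_one_le`), and the error of the line
  count (`abs_card_filter_dvd_sub_le`) — the one-variable form of (5.2) (the paper's two-variable sum
  `∑_{a,b} S₀(R,a,b)…` collapses to `b ≡ an_R`, since `S₀(R, a, b) = N(R)·[R ∣ b − a·2^{1/3}]`).
* `abs_latticeCount_sub_le` — **(5.2) for one `R ∈ 𝒯r`**, `Q < N(R) ≤ 2Q`:
  `|S(R;X) − η²X²/N(R)| ≤ 3X/N(R) + Q⁻¹ ∑_{0<|a|≤Q} ∑_{|b|≤Q} [R ∣ b − a·2^{1/3}] w(a) w'(b)`,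
  `w(a) = min(2X, 2Q/|a|)`, `w'(0) = 2X`, `w'(b) = min(2X, 2Q/|b|)` (centred representatives, the main
  term `L²/N(R) = η²X²/N(R) + O(X/N(R))`).
* On average over `R`: `∑_{R∣J} τ(R)^A ≤ τ(J)^{A+1}`; the terms `b ≠ 0` give
  `Σ₁ = ∑ |ab|^{-1} τ((b − a·2^{1/3}))^{A+1}`, bounded by dyadic blocks and Lemma 4.7
  (`sum_sum_div_abs_le_of_lemma_4_7`, "`Σ₁ ≪ Q(log Q)^{c(A)}`"); the terms `b = 0` by
  `τ((a·2^{1/3})) ≤ τ((2^{1/3}))τ(|a|)^{12}` and the rational moments of `τ` (the paper's ranges `a = 0`,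
  `b = 0`); the main terms by `∑ τ(R)^A/N(R) ≪ (log Q)^{c(A)}` (Lemma 4.2 over `K`,
  `exists_sum_tr_pow_div_absNorm_le`).

## Faithfulness

Lemma 5.1 is obtained in the uniform rendering used by `HeathBrownCubicTypeIProofs` (explicit
`c, C ≥ 0`; all `X ≥ 1`, `0 < η ≤ 1`, `Q > 0`; logarithmic factor `log(Q + 2)^c`), which is what
its application on p. 32 requires; exponents are explicit but not optimised. Only the statement of
Lemma 4.7 enters as a hypothesis.

## References

* D. R. Heath-Brown, *Primes represented by `x³ + 2y³`*, Acta Math. 186 (2001), 1–84: Lemma 5.1 and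
  its proof, pp. 28–30 ((5.1), (5.2), `Σ₁`); p. 21 (first degree primes); Lemma 4.7 (p. 25); Lemma 3.2
  (p. 11). [cite: HeathBrownActa2001, Lemma 5.1]

## Mathlib / tree search

Mathlib: `Ideal.exists_forall_sub_mem_ideal` (CRT), `Ideal.finiteQuotientOfFreeOfNeBot`,
`Ideal.absNorm_apply`, `Submodule.cardQuot_apply`, `Function.Injective.bijective_of_nat_card_le`,
`Ideal.dvd_span_singleton`, `Squarefree.dvd_pow_iff_dvd`, `Int.emod_add_mul_ediv`, `Finset.sum_boole`,
`Finset.sum_nbij'`, `Nat.log`, `Nat.pow_log_le_self`, `Nat.lt_pow_succ_log_self`,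
`Int.natCast_floor_eq_floor`. Tree: `LargeSieveInequality`/`LargeSieveCharacters`
(`Literature.NumberTheory.Sieve.LargeSieve.e`, `norm_sum_Ioc_e_le`, `inv_norm_e_sub_one_le`,
`sum_range_e_mul_div`, `norm_e_sub_one`), `HeathBrownCubicFLSequencesA` (`NormSimple` API:
`normSimple_of_squarefree_absNorm`, `.absNorm_injOn`, `.eq_prod_filter_of_dvd`,
`prod_dvd_of_forall_prime_dvd`), `HeathBrownCubicTypeIProofs` (`HeathBrown2001_typeI_A_of_bounds`,
`sum_filter_dvd_pow_le`, `idealDivisorCount_span_natCast_le`, `span_natCast_ne_bot`,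
`rpow_le_inv_log_two_pow_mul`), `HeathBrownCubicSieveSetupProofs` (`exists_sum_idealDivisorCount_pow_le`),
`DivisorPowerSums` (`exists_sum_sigma_zero_pow_div_le_real`), `HeathBrownCubicTypeITools`
(`latticeCount`, `latticeBox_eq_product`, `mem_filter_dvd_idealsLE_iff`, `idealDivisorCount_mul_le`),
`HeathBrownCubicSieveSetup` (`pairIdeal`, `pairElt_eq_intCast`, `intCoords_eq_zero`, the fact),
`CubeRootTwoField` (`θint`, `θ_pow_three`, `finrank_K`), `IdealNormCount.absNorm_span_natCast`.
-/

noncomputable section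

open NumberField Finset Filter
open scoped Topology ArithmeticFunction.sigma

namespace Literature.NumberTheory.Sieve.CubicSieve

open LFunctions.CubeRootTwoField

/-! ### `𝓞_K/R ≅ ℤ/N(R)` for `R ∈ 𝒯r`: `2^{1/3} ≡ n_R (mod R)` and `R ∩ ℤ = (N(R))` -/

/-- **A prime ideal of prime norm `p` has residue degree one**: `2^{1/3} ≡ m (mod P)` for some
rational integer `m` (the `p` residues `0, 1, …, p − 1` are distinct modulo `P`, since `P ∩ ℤ ∋ p` and
`P ≠ (1)`, hence exhaust `𝓞_K/P`, which has `N(P) = p` elements). This is the description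
"`(p, n − 2^{1/3})`" of the first degree primes (Dedekind, p. 21). [cite: HeathBrownActa2001, §4 p. 21] -/
theorem exists_int_θint_sub_mem_of_prime_absNorm {P : Ideal (𝓞 K)} (hp : (Ideal.absNorm P).Prime) :
    ∃ m : ℤ, θint - (m : 𝓞 K) ∈ P := by
  set p := Ideal.absNorm P with hpdef
  have hP0 : P ≠ ⊥ := fun h => by rw [h, Ideal.absNorm_bot] at hpdef; exact hp.ne_zero hpdef
  have hPtop : P ≠ ⊤ := fun h => by
    rw [h, Ideal.absNorm_top] at hpdef; exact hp.ne_one hpdef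
  haveI : Finite (𝓞 K ⧸ P) := Ideal.finiteQuotientOfFreeOfNeBot P hP0
  have hcard : Nat.card (𝓞 K ⧸ P) = p := by
    rw [hpdef, Ideal.absNorm_apply, Submodule.cardQuot_apply]
  have hpP : ((p : ℤ) : 𝓞 K) ∈ P := by
    have := Ideal.absNorm_mem P
    exact_mod_cast this
  -- the residues `0, …, p-1` are distinct modulo `P`
  set f : Fin p → 𝓞 K ⧸ P := fun i => Ideal.Quotient.mk P ((i : ℕ) : 𝓞 K) with hf
  have hinj : Function.Injective f := by
    intro i j hij
    simp only [hf, Ideal.Quotient.eq] at hij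
    by_contra hne
    have hij' : (((i : ℕ) : ℤ) - ((j : ℕ) : ℤ) : ℤ) ≠ 0 := by
      intro h0; apply hne; ext; omega
    -- `d = i - j` is coprime to `p` since `0 < |d| < p`
    have hcop : IsCoprime ((((i : ℕ) : ℤ) - ((j : ℕ) : ℤ) : ℤ)) (p : ℤ) := by
      rw [Int.isCoprime_iff_gcd_eq_one]
      have hlt : |(((i : ℕ) : ℤ) - ((j : ℕ) : ℤ) : ℤ)| < p := by
        rw [abs_lt]; constructor <;> omega
      have hg := Int.gcd_dvd_right ((((i : ℕ) : ℤ) - ((j : ℕ) : ℤ) : ℤ)) (p : ℤ)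
      have hg' := Int.gcd_dvd_left ((((i : ℕ) : ℤ) - ((j : ℕ) : ℤ) : ℤ)) (p : ℤ)
      rcases (Nat.dvd_prime hp).mp (Int.natCast_dvd_natCast.mp hg) with h | h
      · exact h
      · exfalso
        rw [h] at hg'
        have := Int.le_of_dvd (abs_pos.mpr hij') ((dvd_abs _ _).mpr hg')
        omega
    obtain ⟨u, v, huv⟩ := hcop
    apply hPtop
    rw [Ideal.eq_top_iff_one]
    have h1 : (1 : 𝓞 K) = u * ((((i : ℕ) : ℤ) - ((j : ℕ) : ℤ) : ℤ) : 𝓞 K) + v * ((p : ℤ) : 𝓞 K) := by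
      exact_mod_cast congr_arg (Int.cast : ℤ → 𝓞 K) huv.symm
    rw [h1]
    refine P.add_mem (P.mul_mem_left _ ?_) (P.mul_mem_left _ hpP)
    push_cast
    exact hij
  have hbij : Function.Bijective f := hinj.bijective_of_nat_card_le (by simp [hcard])
  obtain ⟨i, hi⟩ := hbij.2 (Ideal.Quotient.mk P θint)
  refine ⟨(i : ℕ), ?_⟩
  rw [hf, eq_comm, Ideal.Quotient.eq] at hi
  exact_mod_cast hi

/-- **`2^{1/3}` is congruent to a rational integer modulo every `R ∈ 𝒯r`**: for an ideal `R` of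
square-free norm there is `n ∈ ℤ` with `2^{1/3} − n ∈ R` (the prime factors of `R` are first degree
primes with distinct norms; choose `n ≡ m_P (mod N(P))` for each by the Chinese remainder theorem).
Equivalently `ℤ → 𝓞_K/R` is onto, `𝓞_K/R ≅ ℤ/N(R)`. [cite: HeathBrownActa2001, §5 p. 29] -/
theorem exists_int_θint_sub_mem_of_squarefree {R : Ideal (𝓞 K)} (hR : Squarefree (Ideal.absNorm R)) :
    ∃ n : ℤ, θint - (n : 𝓞 K) ∈ R := by
  classical
  have hR0 : R ≠ ⊥ := fun h => by rw [h, Ideal.absNorm_bot] at hR; exact not_squarefree_zero hR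
  have hNS := normSimple_of_squarefree_absNorm hR
  set S := primeFactorsFinset R with hS
  have hSmem : ∀ P ∈ S, P.IsPrime ∧ P ≠ ⊥ ∧ P ∣ R ∧ (Ideal.absNorm P).Prime := by
    intro P hP
    rw [hS, mem_primeFactorsFinset_iff hR0] at hP
    have hP0 : P ≠ ⊥ := ne_bot_of_dvd_ne_bot hR0 hP.2
    exact ⟨hP.1, hP0, hP.2, (hNS hP.1 hP0 hP.2).1⟩
  -- a residue `m_P` for each prime factor
  have hm : ∀ P : S, ∃ m : ℤ, θint - (m : 𝓞 K) ∈ (P : Ideal (𝓞 K)) := fun P =>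
    exists_int_θint_sub_mem_of_prime_absNorm (hSmem P P.2).2.2.2
  choose m hmP using hm
  -- CRT over `ℤ`
  have hcop : Pairwise (Function.onFun IsCoprime
      fun P : S => Ideal.span {((Ideal.absNorm (P : Ideal (𝓞 K)) : ℕ) : ℤ)}) := by
    intro P₁ P₂ hne
    rw [Function.onFun, Ideal.isCoprime_span_singleton_iff]
    have hne' : Ideal.absNorm (P₁ : Ideal (𝓞 K)) ≠ Ideal.absNorm (P₂ : Ideal (𝓞 K)) := by
      intro h
      apply hne
      exact Subtype.ext (hNS.absNorm_injOn hR0 P₁.2 P₂.2 h)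
    exact Int.isCoprime_iff_gcd_eq_one.mpr (by
      rw [Int.gcd_natCast_natCast]
      exact (Nat.coprime_primes (hSmem _ P₁.2).2.2.2 (hSmem _ P₂.2).2.2.2).mpr hne')
  obtain ⟨n, hn⟩ := Ideal.exists_forall_sub_mem_ideal hcop m
  refine ⟨n, ?_⟩
  -- every prime factor divides `(θ − n)`
  have hdvd : ∀ P ∈ S, P ∣ Ideal.span {θint - (n : 𝓞 K)} := by
    intro P hP
    rw [Ideal.dvd_span_singleton]
    have h1 := hmP ⟨P, hP⟩
    have h2 : ((n - m ⟨P, hP⟩ : ℤ) : 𝓞 K) ∈ P := by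
      have h := hn ⟨P, hP⟩
      rw [Ideal.mem_span_singleton] at h
      obtain ⟨t, ht⟩ := h
      rw [ht]
      push_cast
      refine P.mul_mem_right _ ?_
      have := Ideal.absNorm_mem (P : Ideal (𝓞 K))
      exact_mod_cast this
    have h3 : θint - (n : 𝓞 K) = (θint - (m ⟨P, hP⟩ : 𝓞 K)) - ((n - m ⟨P, hP⟩ : ℤ) : 𝓞 K) := by
      push_cast; ring
    rw [h3]
    exact P.sub_mem h1 h2
  have hRprod := hNS.eq_prod_filter_of_dvd hR0 dvd_rfl hR
  rw [← Ideal.dvd_span_singleton, hRprod]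
  exact prod_dvd_of_forall_prime_dvd fun P hP =>
    have hP' : P ∈ S := (Finset.mem_filter.mp hP).1
    ⟨(hSmem P hP').1, (hSmem P hP').2.1, hdvd P hP'⟩

/-- `N((k)) = |k|³` for a rational integer `k`. [folklore] -/
theorem absNorm_span_intCast (k : ℤ) : Ideal.absNorm (Ideal.span {(k : 𝓞 K)}) = k.natAbs ^ 3 := by
  have h : Ideal.span {(k : 𝓞 K)} = Ideal.span {((k.natAbs : ℕ) : 𝓞 K)} := by
    rcases Int.natAbs_eq k with hk | hk
    · conv_lhs => rw [hk]
      simp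
    · conv_lhs => rw [hk]
      rw [Int.cast_neg, Ideal.span_singleton_neg]
      simp
  rw [h, Literature.NumberTheory.LFunctions.IdealNormCount.absNorm_span_natCast K, finrank_K]

/-- **`R ∩ ℤ = (N(R))` for `R ∈ 𝒯r`**: a rational integer `k` lies in an ideal `R` of square-free
norm `N` iff `N ∣ k` (`N ∈ R`; conversely `R ∣ (k)` gives `N ∣ N((k)) = |k|³`, and `N` is
square-free). [cite: HeathBrownActa2001, §5 p. 29] -/
theorem intCast_mem_iff_absNorm_dvd {R : Ideal (𝓞 K)} (hR : Squarefree (Ideal.absNorm R)) (k : ℤ) :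
    (k : 𝓞 K) ∈ R ↔ ((Ideal.absNorm R : ℕ) : ℤ) ∣ k := by
  constructor
  · intro hk
    have h1 : Ideal.absNorm R ∣ k.natAbs ^ 3 := by
      rw [← absNorm_span_intCast]
      exact Ideal.absNorm_dvd_absNorm_of_le ((Ideal.span_singleton_le_iff_mem _).mpr hk)
    rw [hR.dvd_pow_iff_dvd three_ne_zero] at h1
    exact Int.natCast_dvd.mpr h1
  · rintro ⟨t, rfl⟩
    push_cast
    refine R.mul_mem_right _ ?_
    have := Ideal.absNorm_mem R
    exact_mod_cast this

/-- **Membership of `x + y·2^{1/3}` in `R ∈ 𝒯r` is a congruence**: if `2^{1/3} ≡ n (mod R)` then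
`x + y·2^{1/3} ∈ R ⟺ N(R) ∣ x + yn` (`x + y·2^{1/3} = (x + yn) + y(2^{1/3} − n)`). This is the
parametrisation `u ≡ −nv` of the pairs `R ∣ u + v·2^{1/3}` of p. 29 ("the number of pairs `u, v`
modulo `N(R)` for which `R ∣ u + v·2^{1/3}` will be `N(R)`"). [cite: HeathBrownActa2001, §5 p. 29] -/
theorem intCast_add_mul_θint_mem_iff {R : Ideal (𝓞 K)} (hR : Squarefree (Ideal.absNorm R)) {n : ℤ}
    (hn : θint - (n : 𝓞 K) ∈ R) (x y : ℤ) :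
    (x : 𝓞 K) + (y : 𝓞 K) * θint ∈ R ↔ ((Ideal.absNorm R : ℕ) : ℤ) ∣ x + y * n := by
  have h : (x : 𝓞 K) + (y : 𝓞 K) * θint = ((x + y * n : ℤ) : 𝓞 K) + (y : 𝓞 K) * (θint - (n : 𝓞 K)) := by
    push_cast; ring
  rw [h, Ideal.add_mem_iff_left _ (R.mul_mem_left _ hn), intCast_mem_iff_absNorm_dvd hR]

/-- `R ∣ (x + y·2^{1/3})` for a pair of the box iff `N(R) ∣ x + yn`. [cite: HeathBrownActa2001, §5 p. 29] -/
theorem dvd_pairIdeal_iff_absNorm_dvd {R : Ideal (𝓞 K)} (hR : Squarefree (Ideal.absNorm R)) {n : ℤ}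
    (hn : θint - (n : 𝓞 K) ∈ R) (xy : ℕ × ℕ) :
    R ∣ pairIdeal xy ↔ ((Ideal.absNorm R : ℕ) : ℤ) ∣ (xy.1 : ℤ) + (xy.2 : ℤ) * n := by
  rw [pairIdeal, Ideal.dvd_span_singleton, pairElt_eq_intCast, intCast_add_mul_θint_mem_iff hR hn]

/-- `R ∣ (b − a·2^{1/3})` iff `N(R) ∣ b − an` — the criterion "`S₀(R, a, b) = 0` unless
`R ∣ b − a·2^{1/3}`" of p. 30 in congruence form. [cite: HeathBrownActa2001, §5 p. 30] -/
theorem dvd_span_sub_mul_θint_iff {R : Ideal (𝓞 K)} (hR : Squarefree (Ideal.absNorm R)) {n : ℤ}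
    (hn : θint - (n : 𝓞 K) ∈ R) (a b : ℤ) :
    R ∣ Ideal.span {(b : 𝓞 K) - (a : 𝓞 K) * θint} ↔ ((Ideal.absNorm R : ℕ) : ℤ) ∣ b - a * n := by
  rw [Ideal.dvd_span_singleton, show (b : 𝓞 K) - (a : 𝓞 K) * θint = (b : 𝓞 K) + ((-a : ℤ) : 𝓞 K) * θint by
    push_cast; ring, intCast_add_mul_θint_mem_iff hR hn]
  constructor <;> intro h <;> simpa [sub_eq_add_neg] using h

/-! ### Additive characters modulo `N`: orthogonality, geometric sums, the count on a line -/

section Fourier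

open Literature.NumberTheory.Sieve.LargeSieve

/-- Orthogonality of the additive characters modulo `N ≥ 1`, for an arbitrary integer `m`:
`∑_{k<N} e(km/N) = N·[N ∣ m]` (the tree's `LargeSieve.sum_range_e_mul_div` after reducing `m`
modulo `N`). [folklore] -/
theorem sum_range_e_mul_div_eq_ite_dvd {N : ℕ} (hN : 0 < N) (m : ℤ) :
    ∑ k ∈ range N, e ((k : ℝ) * m / N) = if (N : ℤ) ∣ m then (N : ℂ) else 0 := by
  have hN' : (N : ℝ) ≠ 0 := by exact_mod_cast hN.ne'
  have hNz : (N : ℤ) ≠ 0 := by exact_mod_cast hN.ne'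
  set r : ℤ := m % N with hr
  have hr0 : 0 ≤ r := Int.emod_nonneg _ hNz
  have hrN : r < N := Int.emod_lt_of_pos _ (by exact_mod_cast hN)
  have hmr : (m : ℝ) = (r : ℝ) + (N : ℝ) * ((m / N : ℤ) : ℝ) := by
    exact_mod_cast (Int.emod_add_mul_ediv m N).symm
  have hterm : ∀ k ∈ range N, e ((k : ℝ) * m / N) = e ((k : ℝ) * r / N) := by
    intro k _
    have h : (k : ℝ) * m / N = (k : ℝ) * r / N + ((k * (m / N) : ℤ) : ℝ) := by
      rw [hmr]; push_cast; field_simp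
    rw [h, e_add_int]
  rw [sum_congr rfl hterm, sum_range_e_mul_div hN (by rw [abs_lt]; constructor <;> omega)]
  have hiff : r = 0 ↔ (N : ℤ) ∣ m := by rw [hr, Int.dvd_iff_emod_eq_zero]
  by_cases h : (N : ℤ) ∣ m
  · rw [if_pos (hiff.mpr h), if_pos h]
  · rw [if_neg (fun h0 => h (hiff.mp h0)), if_neg h]

/-- **The count on the line `x + ny ≡ 0 (mod N)` by additive characters**: for a finite set `B`
of natural numbers, `#{(x, y) ∈ B² : N ∣ x + ny} = N⁻¹ ∑_{a<N} (∑_{x∈B} e(ax/N)) (∑_{y∈B} e(any/N))`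
(p. 29, with the inner congruence count written through `e_N`). [cite: HeathBrownActa2001, §5 p. 29] -/
theorem card_filter_dvd_eq_sum {N : ℕ} (hN : 0 < N) (n : ℤ) (B : Finset ℕ) :
    ((#{xy ∈ B ×ˢ B | (N : ℤ) ∣ (xy.1 : ℤ) + (xy.2 : ℤ) * n} : ℕ) : ℂ) =
      (N : ℂ)⁻¹ * ∑ a ∈ range N,
        (∑ x ∈ B, e ((a : ℝ) * x / N)) * (∑ y ∈ B, e ((a : ℝ) * (n * y) / N)) := by
  have hNC : (N : ℂ) ≠ 0 := by exact_mod_cast hN.ne'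
  have hind : ∀ xy ∈ B ×ˢ B, (if (N : ℤ) ∣ (xy.1 : ℤ) + (xy.2 : ℤ) * n then (1 : ℂ) else 0) =
      (N : ℂ)⁻¹ * ∑ a ∈ range N, e ((a : ℝ) * (((xy.1 : ℤ) + (xy.2 : ℤ) * n : ℤ) : ℝ) / N) := by
    intro xy _
    rw [sum_range_e_mul_div_eq_ite_dvd hN, eq_inv_mul_iff_mul_eq₀ hNC]
    split_ifs <;> simp
  rw [← sum_boole, sum_congr rfl hind, ← mul_sum, sum_comm]
  congr 1
  refine sum_congr rfl fun a _ => ?_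
  rw [sum_product, sum_mul_sum]
  refine sum_congr rfl fun x _ => sum_congr rfl fun y _ => ?_
  rw [← e_add]
  congr 1
  push_cast
  ring

/-- A trivially bounded geometric sum: `|∑_{A<x≤A+L} e(xt)| ≤ L`. [folklore] -/
theorem norm_sum_Ioc_e_le_length (A L : ℕ) (f : ℕ → ℝ) :
    ‖∑ x ∈ Ioc A (A + L), e (f x)‖ ≤ L := by
  calc ‖∑ x ∈ Ioc A (A + L), e (f x)‖ ≤ ∑ x ∈ Ioc A (A + L), ‖e (f x)‖ := norm_sum_le _ _
    _ = L := by simp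

/-- `e(a/N) ≠ 1` for `0 < a < N`. [folklore] -/
theorem e_div_ne_one {N a : ℕ} (ha : 0 < a) (haN : a < N) : e ((a : ℝ) / N) ≠ 1 := by
  intro h
  have h1 : ‖e ((a : ℝ) / N) - 1‖ = 0 := by rw [h, sub_self, norm_zero]
  rw [norm_e_sub_one, mul_eq_zero, abs_eq_zero] at h1
  rcases h1 with h1 | h1
  · norm_num at h1
  · have hN : (0 : ℝ) < N := by exact_mod_cast ha.trans haN
    have hpos : 0 < Real.sin (Real.pi * ((a : ℝ) / N)) := by
      refine Real.sin_pos_of_pos_of_lt_pi (by positivity) ?_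
      have : (a : ℝ) / N < 1 := by rw [div_lt_one hN]; exact_mod_cast haN
      nlinarith [Real.pi_pos]
    linarith

/-- **The geometric sum bound** `|∑_{A<x≤A+L} e(ax/N)| ≤ N/min(a, N−a)` for `0 < a < N` (the
`min{X, N(R)/|a|}` of (5.2), p. 29; from the tree's `LargeSieve.norm_sum_Ioc_e_le` and
`LargeSieve.inv_norm_e_sub_one_le`). [cite: HeathBrownActa2001, §5 (5.2)] -/
theorem norm_sum_Ioc_e_le_div_min (A L : ℕ) {N a : ℕ} (ha : 0 < a) (haN : a < N) :
    ‖∑ x ∈ Ioc A (A + L), e ((a : ℝ) * x / N)‖ ≤ (N : ℝ) / (min a (N - a) : ℕ) := by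
  have hN : (0 : ℝ) < N := by exact_mod_cast ha.trans haN
  have hterm : ∀ x ∈ Ioc A (A + L), e ((a : ℝ) * x / N) = e ((x : ℕ) * ((a : ℝ) / N)) := by
    intro x _; congr 1; ring
  rw [sum_congr rfl hterm]
  have h1 := norm_sum_Ioc_e_le A L (e_div_ne_one ha haN)
  have h2 := inv_norm_e_sub_one_le ha haN
  have hmin0 : (0 : ℝ) < ((min a (N - a) : ℕ) : ℝ) := by
    have : 0 < min a (N - a) := lt_min ha (Nat.sub_pos_of_lt haN)
    exact_mod_cast this
  have ha' : ((min a (N - a) : ℕ) : ℝ) ≤ a := by exact_mod_cast min_le_left a (N - a)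
  have hb' : ((min a (N - a) : ℕ) : ℝ) ≤ ((N - a : ℕ) : ℝ) := by exact_mod_cast min_le_right a (N - a)
  have ha0 : (0 : ℝ) < a := by exact_mod_cast ha
  have hb0 : (0 : ℝ) < ((N - a : ℕ) : ℝ) := by exact_mod_cast Nat.sub_pos_of_lt haN
  calc ‖∑ x ∈ Ioc A (A + L), e ((x : ℕ) * ((a : ℝ) / N))‖ ≤ 2 / ‖e ((a : ℝ) / N) - 1‖ := h1
    _ = 2 * ‖e ((a : ℝ) / N) - 1‖⁻¹ := by rw [div_eq_mul_inv]
    _ ≤ 2 * ((N : ℝ) / (4 * a) + (N : ℝ) / (4 * (N - a : ℕ))) :=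
        mul_le_mul_of_nonneg_left h2 zero_le_two
    _ ≤ 2 * ((N : ℝ) / (4 * (min a (N - a) : ℕ)) + (N : ℝ) / (4 * (min a (N - a) : ℕ))) := by
        gcongr
    _ = (N : ℝ) / (min a (N - a) : ℕ) := by field_simp; ring

/-- The second geometric sum of the line count, with frequency `an`, reduces to `b ≡ an (mod N)`:
`∑_y e(a·n·y/N) = ∑_y e(b·y/N)`. [folklore] -/
theorem sum_e_mul_eq_sum_e_emod {N : ℕ} (hN : 0 < N) (n : ℤ) (a : ℕ) (B : Finset ℕ) :
    ∑ y ∈ B, e ((a : ℝ) * (n * y) / N) = ∑ y ∈ B, e ((((a * n) % (N : ℤ) : ℤ) : ℝ) * y / N) := by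
  have hN' : (N : ℝ) ≠ 0 := by exact_mod_cast hN.ne'
  refine sum_congr rfl fun y _ => ?_
  set b : ℤ := (a * n) % (N : ℤ) with hb
  have hab : (a : ℝ) * n = (b : ℝ) + (N : ℝ) * (((a * n) / N : ℤ) : ℝ) := by
    exact_mod_cast (Int.emod_add_mul_ediv ((a : ℤ) * n) N).symm
  have h : (a : ℝ) * (n * y) / N = (b : ℝ) * y / N + (((a * n) / N * y : ℤ) : ℝ) := by
    rw [show (a : ℝ) * (n * y) / N = ((a : ℝ) * n) * y / N by ring, hab]
    push_cast; field_simp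
  rw [h, e_add_int]

/-- **The error of the line count** (the shape of (5.2), p. 29): for `N ≥ 1` and a square box
`(A, A+L]²`, `|#{(x,y) : N ∣ x + ny} − L²/N| ≤ N⁻¹ ∑_{0<a<N} |∑_x e(ax/N)| · |∑_y e(any/N)|`
(the term `a = 0` is the main term `L²/N`). [cite: HeathBrownActa2001, §5 (5.2)] -/
theorem abs_card_filter_dvd_sub_le {N : ℕ} (hN : 0 < N) (n : ℤ) (A L : ℕ) :
    |((#{xy ∈ Ioc A (A + L) ×ˢ Ioc A (A + L) | (N : ℤ) ∣ (xy.1 : ℤ) + (xy.2 : ℤ) * n} : ℕ) : ℝ) -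
        (L : ℝ) ^ 2 / N| ≤
      (N : ℝ)⁻¹ * ∑ a ∈ Ico 1 N, ‖∑ x ∈ Ioc A (A + L), e ((a : ℝ) * x / N)‖ *
        ‖∑ y ∈ Ioc A (A + L), e ((a : ℝ) * (n * y) / N)‖ := by
  set B := Ioc A (A + L) with hB
  set F : ℕ → ℂ := fun a => ∑ x ∈ B, e ((a : ℝ) * x / N) with hF
  set G : ℕ → ℂ := fun a => ∑ y ∈ B, e ((a : ℝ) * (n * y) / N) with hG
  have hNC : (N : ℂ) ≠ 0 := by exact_mod_cast hN.ne'
  have hcount := card_filter_dvd_eq_sum hN n B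
  -- split off `a = 0`
  have hsplit : ∑ a ∈ range N, F a * G a = (L : ℂ) ^ 2 + ∑ a ∈ Ico 1 N, F a * G a := by
    rw [Finset.range_eq_Ico, ← Finset.insert_Ico_add_one_left_eq_Ico hN, sum_insert (by simp)]
    congr 1
    simp [hF, hG, hB, e_zero, sq]
  have h : ((((#{xy ∈ B ×ˢ B | (N : ℤ) ∣ (xy.1 : ℤ) + (xy.2 : ℤ) * n} : ℕ) : ℝ) - (L : ℝ) ^ 2 / N : ℝ) : ℂ) =
      (N : ℂ)⁻¹ * ∑ a ∈ Ico 1 N, F a * G a := by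
    push_cast
    rw [hcount, hsplit, mul_add]
    field_simp
    ring
  rw [← Real.norm_eq_abs, ← Complex.norm_real, h, norm_mul, norm_inv, Complex.norm_natCast]
  refine mul_le_mul_of_nonneg_left ((norm_sum_le _ _).trans (le_of_eq ?_)) (by positivity)
  exact sum_congr rfl fun a _ => norm_mul _ _

end Fourier

/-! ### Centred representatives modulo `N` -/

/-- The centred representative `z ↦ z` (`2z ≤ N`) or `z − N` (`2z > N`) of `z ∈ [0, N)` has
absolute value `min(z, N − z) ≤ N/2`. [folklore] -/
theorem abs_centered_eq_min (N : ℕ) {z : ℤ} (h0 : 0 ≤ z) (hz : z < N) :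
    |(if 2 * z ≤ (N : ℤ) then z else z - N)| = min z (N - z) := by
  split_ifs with h
  · rw [abs_of_nonneg h0, min_eq_left (by omega)]
  · rw [abs_of_neg (by omega), min_eq_right (by omega)]; ring

/-- `2·|centred(z)| ≤ N`. [folklore] -/
theorem two_mul_abs_centered_le (N : ℕ) {z : ℤ} (h0 : 0 ≤ z) (hz : z < N) :
    2 * |(if 2 * z ≤ (N : ℤ) then z else z - N)| ≤ N := by
  rw [abs_centered_eq_min N h0 hz]
  rcases le_total z (N - z) with h | h
  · rw [min_eq_left h]; omega
  · rw [min_eq_right h]; omega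

/-- The centred representative is congruent to `z` modulo `N`. [folklore] -/
theorem exists_centered_eq_add_mul (N : ℕ) (z : ℤ) :
    ∃ δ : ℤ, (if 2 * z ≤ (N : ℤ) then z else z - N) = z + δ * N := by
  split_ifs
  · exact ⟨0, by ring⟩
  · exact ⟨-1, by ring⟩

/-- The centred representative of `z ∈ (0, N)` is nonzero. [folklore] -/
theorem centered_ne_zero (N : ℕ) {z : ℤ} (h0 : 0 < z) (hz : z < N) :
    (if 2 * z ≤ (N : ℤ) then z else z - N) ≠ 0 := by
  split_ifs <;> omega

/-- The centring map is injective on `[0, N)`. [folklore] -/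
theorem centered_injOn (N : ℕ) {z₁ z₂ : ℤ} (h₁ : 0 ≤ z₁) (hz₁ : z₁ < N) (h₂ : 0 ≤ z₂) (hz₂ : z₂ < N)
    (h : (if 2 * z₁ ≤ (N : ℤ) then z₁ else z₁ - N) = (if 2 * z₂ ≤ (N : ℤ) then z₂ else z₂ - N)) :
    z₁ = z₂ := by
  split_ifs at h <;> omega

/-! ### The error of `S(R; X)` for one `R ∈ 𝒯r`, in the shape of (5.2) -/

open Literature.NumberTheory.Sieve.LargeSieve in
open scoped Classical in
/-- **The error term of `S(R; X)` for one `R ∈ 𝒯r` with `Q < N(R) ≤ 2Q`** ((5.2), pp. 29–30, in the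
form used for the average over `R`): for `X ≥ 1`, `0 < η ≤ 1`,
`|S(R; X) − η²X²/N(R)| ≤ 3X/N(R) + Q^{-1} ∑_{0<|a|≤Q} ∑_{|b|≤Q} [R ∣ b − a·2^{1/3}] · w(a) w'(b)`,
`w(a) = min(2X, 2Q/|a|)`, `w'(0) = 2X`, `w'(b) = min(2X, 2Q/|b|)`: the congruence count on the line
`x + n_R y ≡ 0 (mod N(R))` by additive characters (`abs_card_filter_dvd_sub_le`), the geometric sums
`min{X, N(R)/|a|}` (`norm_sum_Ioc_e_le_div_min`), the fact that the frequency `b ≡ an_R` of the second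
sum is the unique `b (mod N(R))` with `R ∣ b − a·2^{1/3}` (so the indicator may be inserted and
`(a, b)` centred, `|a|, |b| ≤ N(R)/2 ≤ Q`), and `|L² − η²X²| ≤ 3X` for the number `L` of integers in
`(X, X(1+η)]`. [cite: HeathBrownActa2001, §5 (5.2)] -/
theorem abs_latticeCount_sub_le {R : Ideal (𝓞 K)} (hR : Squarefree (Ideal.absNorm R)) {X η Q : ℝ}
    (hX : 1 ≤ X) (hη0 : 0 < η) (hη1 : η ≤ 1) (hQN : Q < Ideal.absNorm R)
    (hNQ : (Ideal.absNorm R : ℝ) ≤ 2 * Q) :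
    |(latticeCount X η R : ℝ) - η ^ 2 * X ^ 2 / Ideal.absNorm R| ≤
      3 * X / Ideal.absNorm R +
        Q⁻¹ * ∑ s ∈ (Icc (-⌊Q⌋) ⌊Q⌋).filter (· ≠ 0), ∑ t ∈ Icc (-⌊Q⌋) ⌊Q⌋,
          (if R ∣ Ideal.span {(t : 𝓞 K) - (s : 𝓞 K) * θint} then (1 : ℝ) else 0) *
            (min (2 * X) (2 * Q / |(s : ℝ)|) *
              (if t = 0 then 2 * X else min (2 * X) (2 * Q / |(t : ℝ)|))) := by
  -- data
  have hR0 : R ≠ ⊥ := fun h => by rw [h, Ideal.absNorm_bot] at hR; exact not_squarefree_zero hR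
  set N : ℕ := Ideal.absNorm R with hNdef
  have hN1 : 1 ≤ N := Nat.one_le_iff_ne_zero.mpr fun h => hR0 (Ideal.absNorm_eq_zero_iff.mp h)
  have hN : 0 < N := hN1
  have hNr : (1 : ℝ) ≤ N := by exact_mod_cast hN1
  have hNpos : (0 : ℝ) < N := by linarith
  have hQ0 : 0 < Q := by linarith
  have hX0 : 0 < X := by linarith
  obtain ⟨n, hn⟩ := exists_int_θint_sub_mem_of_squarefree hR
  set A : ℕ := ⌊X⌋₊ with hA
  set M : ℕ := ⌊X * (1 + η)⌋₊ with hM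
  have hAM : A ≤ M := Nat.floor_le_floor (by nlinarith)
  set L : ℕ := M - A with hL
  have hML : M = A + L := by omega
  -- the count as a congruence count
  have hcount : latticeCount X η R =
      #{xy ∈ Ioc A (A + L) ×ˢ Ioc A (A + L) | (N : ℤ) ∣ (xy.1 : ℤ) + (xy.2 : ℤ) * n} := by
    rw [latticeCount, latticeBox_eq_product hX0.le, ← hA, ← hM, hML]
    exact congr_arg _ (filter_congr fun xy _ => dvd_pairIdeal_iff_absNorm_dvd hR hn xy)
  -- `|L² − η²X²| ≤ 3X`
  have hLr : (L : ℝ) = M - A := by rw [hL, Nat.cast_sub hAM]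
  have hA1 : (A : ℝ) ≤ X := Nat.floor_le hX0.le
  have hA2 : X < A + 1 := Nat.lt_floor_add_one X
  have hM1 : (M : ℝ) ≤ X * (1 + η) := Nat.floor_le (by positivity)
  have hM2 : X * (1 + η) < M + 1 := Nat.lt_floor_add_one _
  have hLX : |(L : ℝ) - η * X| ≤ 1 := by rw [abs_le, hLr]; constructor <;> nlinarith
  have hL2X : (L : ℝ) ≤ 2 * X := by rw [hLr]; nlinarith
  have hL0 : (0 : ℝ) ≤ L := Nat.cast_nonneg L
  have hL3 : |(L : ℝ) ^ 2 - η ^ 2 * X ^ 2| ≤ 3 * X := by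
    have h1 : (L : ℝ) ^ 2 - η ^ 2 * X ^ 2 = ((L : ℝ) - η * X) * ((L : ℝ) + η * X) := by ring
    rw [h1, abs_mul]
    have h2 : |(L : ℝ) + η * X| ≤ 3 * X := by
      rw [abs_of_nonneg (by positivity)]; nlinarith
    calc |(L : ℝ) - η * X| * |(L : ℝ) + η * X| ≤ 1 * (3 * X) :=
          mul_le_mul hLX h2 (abs_nonneg _) zero_le_one
      _ = 3 * X := one_mul _
  -- the Fourier bound
  have herr := abs_card_filter_dvd_sub_le hN n A L
  rw [← hcount] at herr
  -- the weights
  set W : ℤ → ℝ := fun s => min (2 * X) (2 * Q / |(s : ℝ)|) with hW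
  set W' : ℤ → ℝ := fun t => if t = 0 then 2 * X else min (2 * X) (2 * Q / |(t : ℝ)|) with hW'
  set Φ : ℤ × ℤ → ℝ := fun st =>
    (if R ∣ Ideal.span {(st.2 : 𝓞 K) - (st.1 : 𝓞 K) * θint} then (1 : ℝ) else 0) * (W st.1 * W' st.2)
    with hΦ
  have hW0 : ∀ s, 0 ≤ W s := fun s => by simp only [hW]; exact le_min (by linarith) (by positivity)
  have hW'0 : ∀ t, 0 ≤ W' t := fun t => by
    simp only [hW']; split_ifs; · linarith
    · exact le_min (by linarith) (by positivity)
  have hΦ0 : ∀ st, 0 ≤ Φ st := fun st => by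
    simp only [hΦ]
    exact mul_nonneg (by split_ifs <;> norm_num) (mul_nonneg (hW0 _) (hW'0 _))
  -- centring
  set c : ℤ → ℤ := fun z => if 2 * z ≤ (N : ℤ) then z else z - N with hc
  set ψ : ℕ → ℤ × ℤ := fun a => (c a, c ((a * n) % (N : ℤ))) with hψ
  have hb0 : ∀ a : ℕ, 0 ≤ ((a : ℤ) * n) % (N : ℤ) := fun a => Int.emod_nonneg _ (by exact_mod_cast hN.ne')
  have hbN : ∀ a : ℕ, ((a : ℤ) * n) % (N : ℤ) < N := fun a => Int.emod_lt_of_pos _ (by exact_mod_cast hN)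
  -- (A) pointwise comparison
  have hptw : ∀ a ∈ Ico 1 N, ‖∑ x ∈ Ioc A (A + L), e ((a : ℝ) * x / N)‖ *
      ‖∑ y ∈ Ioc A (A + L), e ((a : ℝ) * (n * y) / N)‖ ≤ Φ (ψ a) := by
    intro a ha
    rw [mem_Ico] at ha
    obtain ⟨ha1, haN⟩ := ha
    set b : ℤ := ((a : ℤ) * n) % (N : ℤ) with hbdef
    -- the indicator is `1`
    have hind : R ∣ Ideal.span {((c b : ℤ) : 𝓞 K) - ((c a : ℤ) : 𝓞 K) * θint} := by
      rw [dvd_span_sub_mul_θint_iff hR hn]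
      obtain ⟨δ₁, h₁⟩ := exists_centered_eq_add_mul N b
      obtain ⟨δ₂, h₂⟩ := exists_centered_eq_add_mul N (a : ℤ)
      have hb : b = (a : ℤ) * n - ((a : ℤ) * n / N) * N := by
        have := Int.emod_add_mul_ediv ((a : ℤ) * n) N; rw [← hbdef] at this; linarith
      simp only [hc]
      rw [h₁, h₂, hb, ← hNdef]
      exact ⟨-((a : ℤ) * n / N) + δ₁ - δ₂ * n, by ring⟩
    -- the first geometric sum
    have hF : ‖∑ x ∈ Ioc A (A + L), e ((a : ℝ) * x / N)‖ ≤ W (c a) := by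
      simp only [hW]
      refine le_min ((norm_sum_Ioc_e_le_length A L _).trans hL2X) ?_
      refine (norm_sum_Ioc_e_le_div_min A L ha1 haN).trans ?_
      have hca : |((c a : ℤ) : ℝ)| = ((min a (N - a) : ℕ) : ℝ) := by
        have h := abs_centered_eq_min N (z := (a : ℤ)) (by omega) (by exact_mod_cast haN)
        simp only [hc]
        rw [show ((N : ℤ) - (a : ℤ)) = ((N - a : ℕ) : ℤ) by omega] at h
        have h' : ((|(if 2 * (a : ℤ) ≤ (N : ℤ) then (a : ℤ) else (a : ℤ) - N)| : ℤ) : ℝ) =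
            ((min (a : ℤ) ((N - a : ℕ) : ℤ) : ℤ) : ℝ) := by rw [h]
        rw [Int.cast_abs] at h'
        rw [h']
        norm_cast
      have hmin0 : (0 : ℝ) < ((min a (N - a) : ℕ) : ℝ) := by
        have : 0 < min a (N - a) := lt_min ha1 (Nat.sub_pos_of_lt haN)
        exact_mod_cast this
      rw [hca, div_le_div_iff₀ hmin0 hmin0]
      nlinarith
    -- the second geometric sum
    have hG : ‖∑ y ∈ Ioc A (A + L), e ((a : ℝ) * (n * y) / N)‖ ≤ W' (c b) := by
      rw [sum_e_mul_eq_sum_e_emod hN n a, ← hbdef]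
      simp only [hW']
      by_cases hbz : b = 0
      · have hcb : c b = 0 := by simp only [hc]; rw [hbz]; simp
        rw [if_pos hcb, hbz]
        refine le_trans ?_ hL2X
        refine (norm_sum_le _ _).trans (le_of_eq ?_)
        simp
      · have hb1 : 0 < b := lt_of_le_of_ne (hb0 a) (Ne.symm hbz)
        have hcb : c b ≠ 0 := centered_ne_zero N hb1 (hbN a)
        rw [if_neg hcb]
        -- `b = b'` a natural number in `(0, N)`
        obtain ⟨b', hb'⟩ : ∃ b' : ℕ, (b' : ℤ) = b := ⟨b.toNat, Int.toNat_of_nonneg hb1.le⟩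
        have hb'1 : 0 < b' := by omega
        have hb'N : b' < N := by have := hbN a; omega
        have hterm : ∀ y ∈ Ioc A (A + L), e ((b : ℝ) * y / N) = e ((b' : ℝ) * y / N) := by
          intro y _; rw [← hb', Int.cast_natCast]
        rw [sum_congr rfl hterm]
        refine le_min ((norm_sum_Ioc_e_le_length A L _).trans hL2X) ?_
        refine (norm_sum_Ioc_e_le_div_min A L hb'1 hb'N).trans ?_
        have hcb' : |((c b : ℤ) : ℝ)| = ((min b' (N - b') : ℕ) : ℝ) := by
          have h := abs_centered_eq_min N (z := b) hb1.le (hbN a)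
          simp only [hc]
          rw [← hb', show ((N : ℤ) - (b' : ℤ)) = ((N - b' : ℕ) : ℤ) by omega] at h
          rw [← hb']
          have h' : ((|(if 2 * (b' : ℤ) ≤ (N : ℤ) then (b' : ℤ) else (b' : ℤ) - N)| : ℤ) : ℝ) =
              ((min (b' : ℤ) ((N - b' : ℕ) : ℤ) : ℤ) : ℝ) := by rw [h]
          rw [Int.cast_abs] at h'
          rw [h']
          norm_cast
        have hmin0 : (0 : ℝ) < ((min b' (N - b') : ℕ) : ℝ) := by
          have : 0 < min b' (N - b') := lt_min hb'1 (Nat.sub_pos_of_lt hb'N)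
          exact_mod_cast this
        rw [hcb', div_le_div_iff₀ hmin0 hmin0]
        nlinarith
    calc ‖∑ x ∈ Ioc A (A + L), e ((a : ℝ) * x / N)‖ * ‖∑ y ∈ Ioc A (A + L), e ((a : ℝ) * (n * y) / N)‖
        ≤ W (c a) * W' (c b) := mul_le_mul hF hG (norm_nonneg _) (hW0 _)
      _ = Φ (ψ a) := by simp only [hΦ, hψ, ← hbdef]; rw [if_pos hind, one_mul]
  -- (B) injectivity of the centring on `[1, N)`
  have hinj : Set.InjOn ψ ↑(Ico 1 N) := by
    intro a₁ h₁ a₂ h₂ h12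
    rw [mem_coe, mem_Ico] at h₁ h₂
    simp only [hψ, Prod.mk.injEq] at h12
    have := centered_injOn N (z₁ := (a₁ : ℤ)) (z₂ := (a₂ : ℤ)) (by omega) (by exact_mod_cast h₁.2)
      (by omega) (by exact_mod_cast h₂.2) h12.1
    exact_mod_cast this
  -- (C) the image lies in the box `T`
  set T := ((Icc (-⌊Q⌋) ⌊Q⌋).filter (· ≠ (0 : ℤ))) ×ˢ (Icc (-⌊Q⌋) ⌊Q⌋) with hT
  have hbox : ∀ z : ℤ, 0 ≤ z → z < N → c z ∈ Icc (-⌊Q⌋) ⌊Q⌋ := by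
    intro z hz0 hzN
    have h2 : 2 * |c z| ≤ (N : ℤ) := two_mul_abs_centered_le N hz0 hzN
    have h2r : (2 : ℝ) * ((|c z| : ℤ) : ℝ) ≤ N := by exact_mod_cast h2
    have habs : ((|c z| : ℤ) : ℝ) ≤ Q := by linarith
    have hfl : |c z| ≤ ⌊Q⌋ := Int.le_floor.mpr habs
    rw [mem_Icc]
    exact ⟨(abs_le.mp hfl).1, (abs_le.mp hfl).2⟩
  have hmaps : ∀ a ∈ Ico 1 N, ψ a ∈ T := by
    intro a ha
    rw [mem_Ico] at ha
    simp only [hT, hψ, mem_product, mem_filter]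
    refine ⟨⟨hbox a (by omega) (by exact_mod_cast ha.2), ?_⟩, hbox _ (hb0 a) (hbN a)⟩
    exact centered_ne_zero N (by exact_mod_cast ha.1) (by exact_mod_cast ha.2)
  -- (D) summation
  have hsum : ∑ a ∈ Ico 1 N, ‖∑ x ∈ Ioc A (A + L), e ((a : ℝ) * x / N)‖ *
      ‖∑ y ∈ Ioc A (A + L), e ((a : ℝ) * (n * y) / N)‖ ≤ ∑ st ∈ T, Φ st := by
    calc ∑ a ∈ Ico 1 N, ‖∑ x ∈ Ioc A (A + L), e ((a : ℝ) * x / N)‖ *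
          ‖∑ y ∈ Ioc A (A + L), e ((a : ℝ) * (n * y) / N)‖
        ≤ ∑ a ∈ Ico 1 N, Φ (ψ a) := sum_le_sum hptw
      _ = ∑ st ∈ (Ico 1 N).image ψ, Φ st := (sum_image hinj).symm
      _ ≤ ∑ st ∈ T, Φ st := sum_le_sum_of_subset_of_nonneg (fun st hst => by
          rw [mem_image] at hst
          obtain ⟨a, ha, rfl⟩ := hst
          exact hmaps a ha) fun st _ _ => hΦ0 st
  have hTsum : ∑ st ∈ T, Φ st = ∑ s ∈ (Icc (-⌊Q⌋) ⌊Q⌋).filter (· ≠ 0), ∑ t ∈ Icc (-⌊Q⌋) ⌊Q⌋, Φ (s, t) :=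
    sum_product _ _ _
  -- assemble
  have hNQ' : (N : ℝ)⁻¹ ≤ Q⁻¹ := inv_anti₀ hQ0 hQN.le
  calc |(latticeCount X η R : ℝ) - η ^ 2 * X ^ 2 / N|
      ≤ |(latticeCount X η R : ℝ) - (L : ℝ) ^ 2 / N| + |(L : ℝ) ^ 2 / N - η ^ 2 * X ^ 2 / N| :=
        abs_sub_le _ _ _
    _ ≤ (N : ℝ)⁻¹ * ∑ st ∈ T, Φ st + 3 * X / N := by
        refine add_le_add (herr.trans (mul_le_mul_of_nonneg_left hsum (by positivity))) ?_
        rw [← sub_div, abs_div, abs_of_pos hNpos]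
        exact div_le_div_of_nonneg_right hL3 hNpos.le
    _ ≤ Q⁻¹ * ∑ st ∈ T, Φ st + 3 * X / N := by
        gcongr
    _ = _ := by rw [add_comm, hTsum]

/-! ### The sum `Σ₁`: dyadic ranges and Lemma 4.7 (p. 30) -/

/-- The box sum of Lemma 4.7 in the variables `(s, t) ↦ (m, n) = (t, −s)`: for natural numbers
`a, b`, `∑_{0<|s|≤a} ∑_{0<|t|≤b} τ((t − s·2^{1/3}))^B = ∑_{0<|m|≤b} ∑_{0<|n|≤a} τ((m + n·2^{1/3}))^B`
(reflect `s ↦ −s` and exchange the sums). [folklore] -/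
theorem sum_sum_sub_eq_sum_sum_add (a b : ℕ) (B : ℕ) :
    ∑ s ∈ (Icc (-(a : ℤ)) a).filter (· ≠ 0), ∑ t ∈ (Icc (-(b : ℤ)) b).filter (· ≠ 0),
        (idealDivisorCount (Ideal.span {(t : 𝓞 K) - (s : 𝓞 K) * θint}) : ℝ) ^ B =
      ∑ m ∈ (Icc (-(b : ℤ)) b).filter (· ≠ 0), ∑ n ∈ (Icc (-(a : ℤ)) a).filter (· ≠ 0),
        (idealDivisorCount (Ideal.span {((m : ℤ) : 𝓞 K) + ((n : ℤ) : 𝓞 K) * θint}) : ℝ) ^ B := by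
  rw [sum_comm]
  refine sum_congr rfl fun t _ => ?_
  refine sum_nbij' (fun s => -s) (fun n => -n) ?_ ?_ (fun s _ => neg_neg s) (fun n _ => neg_neg n) ?_
  · intro s hs
    simp only [mem_filter, mem_Icc] at hs ⊢
    omega
  · intro n hn
    simp only [mem_filter, mem_Icc] at hn ⊢
    omega
  · intro s _
    congr 3
    push_cast
    ring

/-- The dyadic index `i = ⌊log₂|s|⌋` of a nonzero integer with `|s| ≤ q`: `2^i ≤ |s| < 2^{i+1}` and
`i ≤ ⌊log₂ q⌋`. [folklore] -/
theorem dyadic_index_bounds {q : ℕ} {s : ℤ} (hs : s ≠ 0) (hsq : |s| ≤ q) :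
    (2 : ℝ) ^ Nat.log 2 s.natAbs ≤ |(s : ℝ)| ∧ |(s : ℝ)| < (2 : ℝ) ^ (Nat.log 2 s.natAbs + 1) ∧
      Nat.log 2 s.natAbs ≤ Nat.log 2 q := by
  have h0 : s.natAbs ≠ 0 := Int.natAbs_ne_zero.mpr hs
  have habs : |(s : ℝ)| = (s.natAbs : ℝ) := by
    rw [Nat.cast_natAbs, Int.cast_abs]
  refine ⟨?_, ?_, ?_⟩
  · rw [habs]; exact_mod_cast Nat.pow_log_le_self 2 h0
  · rw [habs]; exact_mod_cast Nat.lt_pow_succ_log_self one_lt_two _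
  · refine Nat.log_mono_right ?_
    have : (s.natAbs : ℤ) ≤ q := by rw [← Int.abs_eq_natAbs]; exact hsq
    exact_mod_cast this

/-- **`Σ₁ ≪ (log Q)^{c(A)}`** (p. 30: "We split the available `a, b` into ranges `M ≤ |a| < 2M`,
`N ≤ |b| < 2N`, where `M, N` run over powers of 2. There will be `O((log Q)²)` such pairs `M, N`.
We use Lemma 4.7 for each range, whence `Σ₁ ≪ Q ∑_{M,N} (MN)^{-1} MN (log MN)^{c(A)} ≪ Q(log Q)^{c(A)}`"):
granted Lemma 4.7 for the exponent `B` (constants `c₂, C₂ ≥ 0`), for every `q ∈ ℕ`,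
`∑_{0<|s|≤q} ∑_{0<|t|≤q} τ((t − s·2^{1/3}))^B/(|s||t|) ≤ 16 C₂ 4^{c₂} (log 2)^{-2} · log(q+2)^{c₂+2}`.
[cite: HeathBrownActa2001, §5 p. 30] -/
theorem sum_sum_div_abs_le_of_lemma_4_7 {B : ℕ} {c₂ C₂ : ℝ} (hc₂ : 0 ≤ c₂) (hC₂ : 0 ≤ C₂)
    (h47 : ∀ x y : ℝ, 2 ≤ x → 2 ≤ y →
      ∑ m ∈ (Icc (-⌊x⌋) ⌊x⌋).filter (· ≠ 0), ∑ n ∈ (Icc (-⌊y⌋) ⌊y⌋).filter (· ≠ 0),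
        (idealDivisorCount (Ideal.span {((m : ℤ) : 𝓞 K) + ((n : ℤ) : 𝓞 K) * θint}) : ℝ) ^ B ≤
      C₂ * x * y * Real.log (x * y) ^ c₂)
    (q : ℕ) :
    ∑ s ∈ (Icc (-(q : ℤ)) q).filter (· ≠ 0), ∑ t ∈ (Icc (-(q : ℤ)) q).filter (· ≠ 0),
        (idealDivisorCount (Ideal.span {(t : 𝓞 K) - (s : 𝓞 K) * θint}) : ℝ) ^ B / (|(s : ℝ)| * |(t : ℝ)|) ≤
      16 * C₂ * 4 ^ c₂ * (Real.log 2)⁻¹ ^ 2 * Real.log (q + 2) ^ (c₂ + 2) := by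
  set F : ℕ → Finset ℤ := fun a => (Icc (-(a : ℤ)) a).filter (· ≠ 0) with hF
  set G : ℤ → ℤ → ℝ := fun s t =>
    (idealDivisorCount (Ideal.span {(t : 𝓞 K) - (s : 𝓞 K) * θint}) : ℝ) ^ B with hG
  set ι : ℤ → ℕ := fun s => Nat.log 2 s.natAbs with hι
  set I : ℕ := Nat.log 2 q with hI
  have hl2 : 0 < Real.log 2 := Real.log_pos one_lt_two
  have hlq : Real.log 2 ≤ Real.log (q + 2) := Real.log_le_log two_pos (by linarith [(q.cast_nonneg : (0:ℝ) ≤ q)])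
  have hlq0 : 0 < Real.log (q + 2) := hl2.trans_le hlq
  have hmemF : ∀ {a : ℕ} {s : ℤ}, s ∈ F a ↔ s ≠ 0 ∧ |s| ≤ a := by
    intro a s; simp only [hF, mem_filter, mem_Icc, abs_le]; tauto
  have hG0 : ∀ s t, 0 ≤ G s t := fun s t => by positivity
  -- Lemma 4.7 on the dyadic boxes
  have hbox : ∀ i j : ℕ, ∑ s ∈ F (2 ^ (i + 1)), ∑ t ∈ F (2 ^ (j + 1)), G s t ≤
      C₂ * 2 ^ (j + 1) * 2 ^ (i + 1) * Real.log (2 ^ (j + 1) * 2 ^ (i + 1)) ^ c₂ := by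
    intro i j
    have h := h47 ((2 : ℝ) ^ (j + 1)) ((2 : ℝ) ^ (i + 1))
      (by calc (2 : ℝ) = 2 ^ 1 := (pow_one 2).symm
            _ ≤ 2 ^ (j + 1) := pow_le_pow_right₀ one_le_two (by omega))
      (by calc (2 : ℝ) = 2 ^ 1 := (pow_one 2).symm
            _ ≤ 2 ^ (i + 1) := pow_le_pow_right₀ one_le_two (by omega))
    have hfl : ∀ k : ℕ, ⌊(2 : ℝ) ^ (k + 1)⌋ = ((2 ^ (k + 1) : ℕ) : ℤ) := fun k => by
      rw [show (2 : ℝ) ^ (k + 1) = ((2 ^ (k + 1) : ℕ) : ℝ) by push_cast; ring, Int.floor_natCast]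
    rw [hfl, hfl] at h
    simp only [hG]
    rw [sum_sum_sub_eq_sum_sum_add]
    exact h
  -- dyadic decomposition
  have hterm : ∀ s ∈ F q, ∀ t ∈ F q, G s t / (|(s : ℝ)| * |(t : ℝ)|) ≤
      G s t * (((2 : ℝ) ^ ι s)⁻¹ * ((2 : ℝ) ^ ι t)⁻¹) := by
    intro s hs t ht
    obtain ⟨hs0, hsq⟩ := hmemF.mp hs
    obtain ⟨ht0, htq⟩ := hmemF.mp ht
    obtain ⟨hs1, -, -⟩ := dyadic_index_bounds hs0 hsq
    obtain ⟨ht1, -, -⟩ := dyadic_index_bounds ht0 htq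
    rw [div_eq_mul_inv, mul_inv]
    refine mul_le_mul_of_nonneg_left ?_ (hG0 s t)
    exact mul_le_mul (inv_anti₀ (by positivity) hs1) (inv_anti₀ (by positivity) ht1)
      (by positivity) (by positivity)
  have hmaps : ∀ s ∈ F q, ι s ∈ range (I + 1) := by
    intro s hs
    obtain ⟨hs0, hsq⟩ := hmemF.mp hs
    obtain ⟨-, -, h3⟩ := dyadic_index_bounds hs0 hsq
    rw [mem_range]
    exact Nat.lt_succ_of_le h3
  have hfib_sub : ∀ i : ℕ, (F q).filter (fun s => ι s = i) ⊆ F (2 ^ (i + 1)) := by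
    intro i s hs
    rw [mem_filter] at hs
    obtain ⟨hs, his⟩ := hs
    obtain ⟨hs0, hsq⟩ := hmemF.mp hs
    obtain ⟨-, h2, -⟩ := dyadic_index_bounds hs0 hsq
    have h2' : |(s : ℝ)| < (2 : ℝ) ^ (i + 1) := by rw [← his]; exact h2
    refine hmemF.mpr ⟨hs0, ?_⟩
    have h' : ((|s| : ℤ) : ℝ) < (((2 ^ (i + 1) : ℕ) : ℤ) : ℝ) := by
      rw [Int.cast_abs]; push_cast; exact h2'
    exact (Int.cast_lt.mp h').le
  calc ∑ s ∈ F q, ∑ t ∈ F q, G s t / (|(s : ℝ)| * |(t : ℝ)|)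
      ≤ ∑ s ∈ F q, ∑ t ∈ F q, G s t * (((2 : ℝ) ^ ι s)⁻¹ * ((2 : ℝ) ^ ι t)⁻¹) :=
        sum_le_sum fun s hs => sum_le_sum fun t ht => hterm s hs t ht
    _ = ∑ i ∈ range (I + 1), ∑ s ∈ (F q).filter (fun s => ι s = i),
          ∑ j ∈ range (I + 1), ∑ t ∈ (F q).filter (fun t => ι t = j),
            G s t * (((2 : ℝ) ^ i)⁻¹ * ((2 : ℝ) ^ j)⁻¹) := by
        rw [← sum_fiberwise_of_maps_to hmaps]
        refine sum_congr rfl fun i _ => sum_congr rfl fun s hs => ?_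
        rw [(mem_filter.mp hs).2, ← sum_fiberwise_of_maps_to hmaps]
        refine sum_congr rfl fun j _ => sum_congr rfl fun t ht => ?_
        rw [(mem_filter.mp ht).2]
    _ = ∑ i ∈ range (I + 1), ∑ j ∈ range (I + 1), (((2 : ℝ) ^ i)⁻¹ * ((2 : ℝ) ^ j)⁻¹) *
          ∑ s ∈ (F q).filter (fun s => ι s = i), ∑ t ∈ (F q).filter (fun t => ι t = j), G s t := by
        refine sum_congr rfl fun i _ => ?_
        rw [sum_comm]
        refine sum_congr rfl fun j _ => ?_
        rw [mul_sum]
        refine sum_congr rfl fun s _ => ?_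
        rw [mul_sum]
        refine sum_congr rfl fun t _ => ?_
        ring
    _ ≤ ∑ i ∈ range (I + 1), ∑ j ∈ range (I + 1), (((2 : ℝ) ^ i)⁻¹ * ((2 : ℝ) ^ j)⁻¹) *
          (C₂ * 2 ^ (j + 1) * 2 ^ (i + 1) * Real.log (2 ^ (j + 1) * 2 ^ (i + 1)) ^ c₂) := by
        refine sum_le_sum fun i _ => sum_le_sum fun j _ => mul_le_mul_of_nonneg_left ?_ (by positivity)
        refine le_trans ?_ (hbox i j)
        refine (sum_le_sum_of_subset_of_nonneg (hfib_sub i) fun s _ _ =>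
          sum_nonneg fun t _ => hG0 s t).trans ?_
        exact sum_le_sum fun s _ => sum_le_sum_of_subset_of_nonneg (hfib_sub j) fun t _ _ => hG0 s t
    _ ≤ ∑ i ∈ range (I + 1), ∑ j ∈ range (I + 1), 4 * C₂ * (4 * Real.log (q + 2)) ^ c₂ := by
        refine sum_le_sum fun i hi => sum_le_sum fun j hj => ?_
        rw [mem_range] at hi hj
        have hlog : Real.log (2 ^ (j + 1) * 2 ^ (i + 1)) ≤ 4 * Real.log (q + 2) := by
          rw [← pow_add, Real.log_pow]
          -- `(j+1+(i+1)) log 2 ≤ (2I+2) log 2 ≤ 4 log(q+2)` since `I log 2 ≤ log q ≤ log(q+2)`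
          have hIq : (I : ℝ) * Real.log 2 ≤ Real.log (q + 2) := by
            rcases Nat.eq_zero_or_pos q with hq | hq
            · have : I = 0 := by rw [hI, hq]; simp
              rw [this]; simp; exact hlq0.le
            · calc (I : ℝ) * Real.log 2 = Real.log (2 ^ I) := by rw [Real.log_pow]
                _ ≤ Real.log q := Real.log_le_log (by positivity) (by
                    exact_mod_cast Nat.pow_log_le_self 2 hq.ne')
                _ ≤ Real.log (q + 2) := Real.log_le_log (by exact_mod_cast hq) (by linarith)
          have hij : ((j + 1 + (i + 1) : ℕ) : ℝ) ≤ 2 * I + 2 := by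
            have : j + 1 + (i + 1) ≤ 2 * I + 2 := by omega
            exact_mod_cast this
          calc ((j + 1 + (i + 1) : ℕ) : ℝ) * Real.log 2 ≤ (2 * I + 2) * Real.log 2 :=
                mul_le_mul_of_nonneg_right hij hl2.le
            _ = 2 * (I * Real.log 2) + 2 * Real.log 2 := by ring
            _ ≤ 2 * Real.log (q + 2) + 2 * Real.log (q + 2) := by linarith
            _ = 4 * Real.log (q + 2) := by ring
        have hlog0 : 0 ≤ Real.log (2 ^ (j + 1) * 2 ^ (i + 1)) := Real.log_nonneg (by
          calc (1 : ℝ) ≤ 2 ^ (j + 1) := one_le_pow₀ one_le_two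
            _ ≤ 2 ^ (j + 1) * 2 ^ (i + 1) := le_mul_of_one_le_right (by positivity) (one_le_pow₀ one_le_two))
        calc (((2 : ℝ) ^ i)⁻¹ * ((2 : ℝ) ^ j)⁻¹) *
              (C₂ * 2 ^ (j + 1) * 2 ^ (i + 1) * Real.log (2 ^ (j + 1) * 2 ^ (i + 1)) ^ c₂)
            = 4 * C₂ * Real.log (2 ^ (j + 1) * 2 ^ (i + 1)) ^ c₂ := by field_simp; ring
          _ ≤ 4 * C₂ * (4 * Real.log (q + 2)) ^ c₂ :=
              mul_le_mul_of_nonneg_left (Real.rpow_le_rpow hlog0 hlog hc₂) (by positivity)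
    _ = ((I : ℝ) + 1) ^ 2 * (4 * C₂ * (4 * Real.log (q + 2)) ^ c₂) := by
        rw [sum_const, sum_const, card_range, nsmul_eq_mul, nsmul_eq_mul]; push_cast; ring
    _ ≤ (2 * Real.log (q + 2) / Real.log 2) ^ 2 * (4 * C₂ * (4 * Real.log (q + 2)) ^ c₂) := by
        refine mul_le_mul_of_nonneg_right (pow_le_pow_left₀ (by positivity) ?_ 2) (by positivity)
        rw [le_div_iff₀ hl2]
        have hIq : (I : ℝ) * Real.log 2 ≤ Real.log (q + 2) := by
          rcases Nat.eq_zero_or_pos q with hq | hq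
          · have : I = 0 := by rw [hI, hq]; simp
            rw [this]; simp; exact hlq0.le
          · calc (I : ℝ) * Real.log 2 = Real.log (2 ^ I) := by rw [Real.log_pow]
              _ ≤ Real.log q := Real.log_le_log (by positivity) (by
                  exact_mod_cast Nat.pow_log_le_self 2 hq.ne')
              _ ≤ Real.log (q + 2) := Real.log_le_log (by exact_mod_cast hq) (by linarith)
        nlinarith
    _ = 16 * C₂ * 4 ^ c₂ * (Real.log 2)⁻¹ ^ 2 * Real.log (q + 2) ^ (c₂ + 2) := by
        rw [Real.mul_rpow (by norm_num) hlq0.le, Real.rpow_add hlq0, Real.rpow_two]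
        field_simp
        ring

/-! ### The average of `τ(R)^A/N(R)` over `Q < N(R) ≤ 2Q` -/

open scoped Classical in
/-- `∑_{Q<N(R)≤2Q, R∈𝒯r} τ(R)^A/N(R) ≤ D log(Q+2)^k` for all `Q > 0` (Lemma 4.2 over `K`; for `Q < 1` the
only possible `R` is `(1)`). [cite: HeathBrownActa2001, Lemma 4.2] -/
theorem exists_sum_tr_pow_div_absNorm_le (A : ℕ) :
    ∃ k : ℕ, ∃ D : ℝ, 0 ≤ D ∧ ∀ Q : ℝ, 0 < Q →
      ∑ R ∈ (idealsLE ⌊2 * Q⌋₊).filter (fun R => Q < (Ideal.absNorm R : ℝ) ∧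
          (Ideal.absNorm R : ℝ) ≤ 2 * Q ∧ Squarefree (Ideal.absNorm R)),
        (idealDivisorCount R : ℝ) ^ A / Ideal.absNorm R ≤ D * Real.log (Q + 2) ^ k := by
  obtain ⟨C₃, hC₃, h42⟩ := exists_sum_idealDivisorCount_pow_le A
  obtain ⟨k, hk⟩ : ∃ k : ℕ, k = 2 ^ (4 * A + 4) := ⟨_, rfl⟩
  rw [← hk] at h42
  have hl2 : 0 < Real.log 2 := Real.log_pos one_lt_two
  refine ⟨k, 2 * C₃ * 2 ^ k + (Real.log 2)⁻¹ ^ k, by positivity, fun Q hQ => ?_⟩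
  set tr := (idealsLE ⌊2 * Q⌋₊).filter (fun R => Q < (Ideal.absNorm R : ℝ) ∧
    (Ideal.absNorm R : ℝ) ≤ 2 * Q ∧ Squarefree (Ideal.absNorm R)) with htr
  have hL2 : Real.log 2 ≤ Real.log (Q + 2) := Real.log_le_log two_pos (by linarith)
  have hL0 : 0 < Real.log (Q + 2) := hl2.trans_le hL2
  have hratio : 1 ≤ (Real.log 2)⁻¹ ^ k * Real.log (Q + 2) ^ k := by
    rw [← mul_pow]; exact one_le_pow₀ (by rw [le_inv_mul_iff₀ hl2]; linarith)
  have hsub : tr ⊆ (idealsLE ⌊2 * Q⌋₊).filter (· ≠ ⊥) := by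
    intro R hR
    rw [htr, mem_filter] at hR
    refine mem_filter.mpr ⟨hR.1, fun h0 => ?_⟩
    rw [h0, Ideal.absNorm_bot, Nat.cast_zero] at hR
    linarith [hR.2.1]
  by_cases hQ1 : 1 ≤ Q
  · -- Lemma 4.2 over `K` on `0 < N(R) ≤ ⌊2Q⌋`
    set M : ℕ := ⌊2 * Q⌋₊ with hM
    have hM2 : 2 ≤ M := Nat.le_floor (by push_cast; linarith)
    have hMQ : (M : ℝ) ≤ 2 * Q := Nat.floor_le (by linarith)
    have hM1 : (1 : ℝ) ≤ M := by exact_mod_cast le_trans one_le_two hM2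
    have hlogM : Real.log M ≤ 2 * Real.log (Q + 2) := by
      calc Real.log M ≤ Real.log (2 * Q) := Real.log_le_log (by linarith) hMQ
        _ = Real.log 2 + Real.log Q := Real.log_mul two_ne_zero hQ.ne'
        _ ≤ Real.log (Q + 2) + Real.log (Q + 2) :=
            add_le_add hL2 (Real.log_le_log hQ (by linarith))
        _ = 2 * Real.log (Q + 2) := by ring
    have hlogM0 : 0 ≤ Real.log M := Real.log_nonneg hM1
    calc ∑ R ∈ tr, (idealDivisorCount R : ℝ) ^ A / Ideal.absNorm R
        ≤ ∑ R ∈ tr, (idealDivisorCount R : ℝ) ^ A / Q := by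
          refine sum_le_sum fun R hR => ?_
          rw [htr, mem_filter] at hR
          exact div_le_div_of_nonneg_left (by positivity) hQ hR.2.1.le
      _ = Q⁻¹ * ∑ R ∈ tr, (idealDivisorCount R : ℝ) ^ A := by simp only [div_eq_inv_mul, mul_sum]
      _ ≤ Q⁻¹ * (C₃ * M * Real.log M ^ k) := by
          refine mul_le_mul_of_nonneg_left ?_ (by positivity)
          exact (sum_le_sum_of_subset_of_nonneg hsub fun R _ _ => by positivity).trans (h42 M hM2)
      _ ≤ Q⁻¹ * (C₃ * (2 * Q) * (2 * Real.log (Q + 2)) ^ k) := by gcongr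
      _ = 2 * C₃ * 2 ^ k * Real.log (Q + 2) ^ k := by rw [mul_pow]; field_simp
      _ ≤ (2 * C₃ * 2 ^ k + (Real.log 2)⁻¹ ^ k) * Real.log (Q + 2) ^ k := by
          rw [add_mul]; linarith [(by positivity : 0 ≤ (Real.log 2)⁻¹ ^ k * Real.log (Q + 2) ^ k)]
  · -- `Q < 1`: only `R = (1)` can occur
    rw [not_le] at hQ1
    have hsub1 : tr ⊆ {⊤} := by
      intro R hR
      rw [htr, mem_filter] at hR
      obtain ⟨-, hQR, hR2, -⟩ := hR
      have h2 : (Ideal.absNorm R : ℝ) < 2 := by linarith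
      have h1 : Ideal.absNorm R = 1 := by
        have : Ideal.absNorm R < 2 := by exact_mod_cast h2
        have h0 : 0 < Ideal.absNorm R := by
          have : (0 : ℝ) < Ideal.absNorm R := hQ.trans hQR
          exact_mod_cast this
        omega
      rw [mem_singleton]
      exact Ideal.absNorm_eq_one_iff.mp h1
    have htop : idealDivisorCount (⊤ : Ideal (𝓞 K)) = 1 := by
      have hset : (idealsLE (Ideal.absNorm (⊤ : Ideal (𝓞 K)))).filter (· ∣ ⊤) = {⊤} := by
        ext D
        rw [mem_filter_dvd_idealsLE_iff (by simp), mem_singleton]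
        constructor
        · intro h
          exact Ideal.isUnit_iff.mp (isUnit_of_dvd_one (by rwa [Ideal.one_eq_top]))
        · rintro rfl; exact dvd_rfl
      unfold idealDivisorCount
      rw [hset, card_singleton]
    calc ∑ R ∈ tr, (idealDivisorCount R : ℝ) ^ A / Ideal.absNorm R
        ≤ ∑ R ∈ ({⊤} : Finset (Ideal (𝓞 K))), (idealDivisorCount R : ℝ) ^ A / Ideal.absNorm R :=
          sum_le_sum_of_subset_of_nonneg hsub1 fun R _ _ => by positivity
      _ = 1 := by simp [htop]
      _ ≤ (Real.log 2)⁻¹ ^ k * Real.log (Q + 2) ^ k := hratio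
      _ ≤ (2 * C₃ * 2 ^ k + (Real.log 2)⁻¹ ^ k) * Real.log (Q + 2) ^ k := by
          rw [add_mul]; linarith [(by positivity : 0 ≤ 2 * C₃ * 2 ^ k * Real.log (Q + 2) ^ k)]

/-! ### The terms `b = 0`: `τ((a·2^{1/3})) ≤ τ((2^{1/3}))·τ(|a|)^{12}` -/

/-- `(s) = (|s|)` as ideals, for an integer `s`. [folklore] -/
theorem span_intCast_eq_span_natAbs (s : ℤ) :
    Ideal.span {(s : 𝓞 K)} = Ideal.span {((s.natAbs : ℕ) : 𝓞 K)} := by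
  rcases Int.natAbs_eq s with hs | hs
  · conv_lhs => rw [hs]
    simp
  · conv_lhs => rw [hs]
    rw [Int.cast_neg, Ideal.span_singleton_neg]
    simp

/-- For `a ≠ 0`: `τ((−a·2^{1/3})) ≤ τ((2^{1/3}))·τ(|a|)^{12}` (Lemma 4.3 and `τ((a)) ≤ τ(|a|)^{12}`).
[folklore] -/
theorem idealDivisorCount_span_mul_θint_le {s : ℤ} (hs : s ≠ 0) :
    idealDivisorCount (Ideal.span {((0 : ℤ) : 𝓞 K) - (s : 𝓞 K) * θint}) ≤
      idealDivisorCount (Ideal.span {θint}) * σ 0 s.natAbs ^ 12 := by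
  have h0 : Ideal.span {((0 : ℤ) : 𝓞 K) - (s : 𝓞 K) * θint} = Ideal.span {θint} * Ideal.span {(s : 𝓞 K)} := by
    rw [Ideal.span_singleton_mul_span_singleton, Int.cast_zero, zero_sub, Ideal.span_singleton_neg,
      mul_comm (s : 𝓞 K) θint]
  have hs' : 0 < s.natAbs := Int.natAbs_pos.mpr hs
  have hθ0 : Ideal.span {θint} ≠ ⊥ := by
    rw [Ne, Ideal.span_singleton_eq_bot]
    intro h
    have := congr_arg (algebraMap (𝓞 K) K) h
    simp only [map_zero] at this
    have h3 := θ_pow_three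
    rw [show algebraMap (𝓞 K) K θint = θ from rfl] at this
    rw [this] at h3
    norm_num at h3
  have hsbot : Ideal.span {(s : 𝓞 K)} ≠ ⊥ := by
    rw [span_intCast_eq_span_natAbs]; exact span_natCast_ne_bot hs'
  rw [h0]
  refine (idealDivisorCount_mul_le hθ0 hsbot).trans (Nat.mul_le_mul_left _ ?_)
  rw [span_intCast_eq_span_natAbs]
  exact idealDivisorCount_span_natCast_le hs'

/-- The reflection `s ↦ |s|` folds the sum over `0 < |s| ≤ q` onto `1 ≤ d ≤ q` twice. [folklore] -/
theorem sum_filter_ne_zero_natAbs_le (q : ℕ) (g : ℕ → ℝ) :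
    ∑ s ∈ (Icc (-(q : ℤ)) q).filter (· ≠ 0), g s.natAbs ≤ 2 * ∑ d ∈ Icc 1 q, g d := by
  have hsplit : (Icc (-(q : ℤ)) q).filter (· ≠ 0) =
      (Icc (-(q : ℤ)) q).filter (fun s => 0 < s) ∪ (Icc (-(q : ℤ)) q).filter (fun s => s < 0) := by
    ext s; simp only [mem_filter, mem_union, mem_Icc]; omega
  have hdisj : Disjoint ((Icc (-(q : ℤ)) q).filter (fun s => 0 < s)) ((Icc (-(q : ℤ)) q).filter (fun s => s < 0)) := by
    rw [disjoint_filter]; intro s _ h1 h2; omega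
  have hpos : ∑ s ∈ (Icc (-(q : ℤ)) q).filter (fun s => 0 < s), g s.natAbs = ∑ d ∈ Icc 1 q, g d := by
    refine sum_nbij' (fun s => s.natAbs) (fun d => (d : ℤ)) ?_ ?_ ?_ ?_ (fun _ _ => rfl)
    · intro s hs; simp only [mem_filter, mem_Icc] at hs; simp only [mem_Icc]; omega
    · intro d hd; simp only [mem_Icc] at hd; simp only [mem_filter, mem_Icc]; omega
    · intro s hs; simp only [mem_filter, mem_Icc] at hs; omega
    · intro d _; simp
  have hneg : ∑ s ∈ (Icc (-(q : ℤ)) q).filter (fun s => s < 0), g s.natAbs = ∑ d ∈ Icc 1 q, g d := by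
    refine sum_nbij' (fun s => s.natAbs) (fun d => -(d : ℤ)) ?_ ?_ ?_ ?_ (fun _ _ => rfl)
    · intro s hs; simp only [mem_filter, mem_Icc] at hs; simp only [mem_Icc]; omega
    · intro d hd; simp only [mem_Icc] at hd; simp only [mem_filter, mem_Icc]; omega
    · intro s hs; simp only [mem_filter, mem_Icc] at hs; omega
    · intro d _; simp
  rw [hsplit, sum_union hdisj, hpos, hneg]
  linarith

/-! ### Lemma 5.1 from Lemma 4.7 -/

set_option maxHeartbeats 1000000 in
-- a single long assembly of explicit estimates; the default budget is exceeded by the bookkeeping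
open scoped Classical in
/-- **Heath-Brown's Lemma 5.1 deduced from the estimate of Lemma 4.7** (pp. 28–30): granted, for every
`A ≥ 1`, constants `c, C ≥ 0` with `∑_{|m|≤x, |n|≤y, mn≠0} τ((m + n·2^{1/3}))^A ≤ C xy (log xy)^c` for
`x, y ≥ 2`, then for every `A ≥ 1` there are `c, C ≥ 0` with
`∑_{Q<N(R)≤2Q, R∈𝒯r} τ(R)^A |S(R; X) − η²X²/N(R)| ≤ C (X + Q) log(Q+2)^c` for all `X ≥ 1`, `0 < η ≤ 1`,
`Q > 0` (the statement of Lemma 5.1 as rendered in `HeathBrownCubicTypeIProofs`). Proof as printed: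
(5.2) for each `R` (`abs_latticeCount_sub_le`), then on average over `R` the divisor bound
`∑_{R∣J} τ(R)^A ≤ τ(J)^{A+1}`, the ranges `a, b ≠ 0` by dyadic blocks and Lemma 4.7
(`sum_sum_div_abs_le_of_lemma_4_7`: "`Σ₁ ≪ Q(log Q)^{c(A)}`"), the range `b = 0` by
`τ((a·2^{1/3})) ≪ τ(|a|)^{c}` and the rational moments of `τ` ("by Lemma 4.2"), and the main terms by
`∑ τ(R)^A/N(R) ≪ (log Q)^{c(A)}` (Lemma 4.2 over `K`). [cite: HeathBrownActa2001, Lemma 5.1] -/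
theorem lemma_5_1_bound_of_lemma_4_7_bound
    (h47 : ∀ A : ℕ, 0 < A → ∃ c C : ℝ, 0 ≤ c ∧ 0 ≤ C ∧ ∀ x y : ℝ, 2 ≤ x → 2 ≤ y →
      ∑ m ∈ (Icc (-⌊x⌋) ⌊x⌋).filter (· ≠ 0), ∑ n ∈ (Icc (-⌊y⌋) ⌊y⌋).filter (· ≠ 0),
        (idealDivisorCount (Ideal.span {((m : ℤ) : 𝓞 K) + ((n : ℤ) : 𝓞 K) * θint}) : ℝ) ^ A ≤
      C * x * y * Real.log (x * y) ^ c)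
    (A : ℕ) (_ : 0 < A) :
    ∃ c C : ℝ, 0 ≤ c ∧ 0 ≤ C ∧ ∀ X η Q : ℝ, 1 ≤ X → 0 < η → η ≤ 1 → 0 < Q →
      ∑ R ∈ (idealsLE ⌊2 * Q⌋₊).filter (fun R => Q < (Ideal.absNorm R : ℝ) ∧
          (Ideal.absNorm R : ℝ) ≤ 2 * Q ∧ Squarefree (Ideal.absNorm R)),
        (idealDivisorCount R : ℝ) ^ A * |(latticeCount X η R : ℝ) - η ^ 2 * X ^ 2 / Ideal.absNorm R| ≤
      C * (X + Q) * Real.log (Q + 2) ^ c := by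
  obtain ⟨c₂, C₂, hc₂, hC₂, H47⟩ := h47 (A + 1) (Nat.succ_pos A)
  obtain ⟨k₁, D₁, hD₁, HE1⟩ := exists_sum_tr_pow_div_absNorm_le A
  obtain ⟨C₄, hC₄, H4div⟩ := exists_sum_sigma_zero_pow_div_le_real (12 * (A + 1))
  obtain ⟨k₄, hk₄⟩ : ∃ k₄ : ℕ, k₄ = 2 ^ (12 * (A + 1) + 1) := ⟨_, rfl⟩
  rw [← hk₄] at H4div
  obtain ⟨T₀, hT₀⟩ : ∃ T₀ : ℝ, T₀ = (idealDivisorCount (Ideal.span {θint}) : ℝ) := ⟨_, rfl⟩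
  have hT₀0 : 0 ≤ T₀ := by rw [hT₀]; exact Nat.cast_nonneg _
  set e₂ : ℝ := c₂ + 2 with he₂
  set cfin : ℝ := (k₁ : ℝ) + e₂ + k₄ with hcfin
  set M : ℝ := (Real.log 2)⁻¹ ^ cfin with hM
  set K₁ : ℝ := 3 * D₁ with hK₁
  set K₂ : ℝ := 4 * (16 * C₂ * 4 ^ c₂ * (Real.log 2)⁻¹ ^ 2) with hK₂
  set K₃ : ℝ := 8 * T₀ ^ (A + 1) * C₄ with hK₃
  have hl2 : 0 < Real.log 2 := Real.log_pos one_lt_two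
  have hk₁0 : (0 : ℝ) ≤ k₁ := Nat.cast_nonneg _
  have hk₄0 : (0 : ℝ) ≤ k₄ := Nat.cast_nonneg _
  have he₂0 : 0 ≤ e₂ := by rw [he₂]; linarith only [hc₂]
  have he₁c : (k₁ : ℝ) ≤ cfin := by rw [hcfin]; linarith only [he₂0, hk₄0]
  have he₂c : e₂ ≤ cfin := by rw [hcfin]; linarith only [hk₁0, hk₄0]
  have he₃c : (k₄ : ℝ) ≤ cfin := by rw [hcfin]; linarith only [hk₁0, he₂0]
  have hK₁0 : 0 ≤ K₁ := by positivity
  have hK₂0 : 0 ≤ K₂ := by positivity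
  have hK₃0 : 0 ≤ K₃ := by positivity
  refine ⟨cfin, (K₁ + K₂ + K₃) * M, by positivity, by positivity, fun X η Q hX hη0 hη1 hQ => ?_⟩
  set L : ℝ := Real.log (Q + 2) with hL
  have hL2 : Real.log 2 ≤ L := Real.log_le_log two_pos (by linarith only [hQ])
  have hL0 : 0 < L := hl2.trans_le hL2
  have hX0 : 0 < X := by linarith only [hX]
  set q : ℕ := ⌊Q⌋₊ with hq
  have hqQ : (⌊Q⌋ : ℤ) = (q : ℤ) := (Int.natCast_floor_eq_floor hQ.le).symm
  have hqle : (q : ℝ) ≤ Q := Nat.floor_le hQ.le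
  have hlogq : Real.log (q + 2) ≤ L := Real.log_le_log (by positivity) (by linarith only [hqle])
  have hlogq0 : 0 < Real.log (q + 2) := hl2.trans_le (Real.log_le_log two_pos (by linarith only [(q.cast_nonneg : (0:ℝ) ≤ q)]))
  have hmain := HE1 Q hQ
  set tr := (idealsLE ⌊2 * Q⌋₊).filter (fun R => Q < (Ideal.absNorm R : ℝ) ∧
    (Ideal.absNorm R : ℝ) ≤ 2 * Q ∧ Squarefree (Ideal.absNorm R)) with htr
  clear_value tr
  set Fq : Finset ℤ := (Icc (-(q : ℤ)) q).filter (· ≠ 0) with hFq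
  set Iq : Finset ℤ := Icc (-(q : ℤ)) q with hIq
  set W : ℤ → ℝ := fun s => min (2 * X) (2 * Q / |(s : ℝ)|) with hW
  set W' : ℤ → ℝ := fun t => if t = 0 then 2 * X else min (2 * X) (2 * Q / |(t : ℝ)|) with hW'
  set J : ℤ → ℤ → Ideal (𝓞 K) := fun s t => Ideal.span {(t : 𝓞 K) - (s : 𝓞 K) * θint} with hJ
  have hW0 : ∀ s, 0 ≤ W s := fun s => le_min (by linarith only [hX0]) (by positivity)
  have hW'0 : ∀ t, 0 ≤ W' t := fun t => by
    simp only [hW']; split_ifs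
    · linarith only [hX0]
    · exact le_min (by linarith only [hX0]) (by positivity)
  have hWle : ∀ s : ℤ, s ≠ 0 → W s ≤ 2 * Q / |(s : ℝ)| := fun s _ => min_le_right _ _
  -- Step 1: the bound for each `R`
  have hstep1 : ∀ R ∈ tr, (idealDivisorCount R : ℝ) ^ A *
      |(latticeCount X η R : ℝ) - η ^ 2 * X ^ 2 / Ideal.absNorm R| ≤
      (idealDivisorCount R : ℝ) ^ A * (3 * X / Ideal.absNorm R +
        Q⁻¹ * ∑ s ∈ Fq, ∑ t ∈ Iq, (if R ∣ J s t then (1 : ℝ) else 0) * (W s * W' t)) := by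
    intro R hR
    rw [htr, mem_filter] at hR
    obtain ⟨-, hQR, hR2, hsq⟩ := hR
    refine mul_le_mul_of_nonneg_left ?_ (by positivity)
    have h := abs_latticeCount_sub_le hsq hX hη0 hη1 hQR hR2
    rw [hqQ] at h
    exact h
  -- Step 2: sum over `R` and interchange
  have hswap : ∀ R ∈ tr, (idealDivisorCount R : ℝ) ^ A *
      (Q⁻¹ * ∑ s ∈ Fq, ∑ t ∈ Iq, (if R ∣ J s t then (1 : ℝ) else 0) * (W s * W' t)) =
      Q⁻¹ * ∑ s ∈ Fq, ∑ t ∈ Iq, W s * W' t *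
        (if R ∣ J s t then (idealDivisorCount R : ℝ) ^ A else 0) := by
    intro R _
    simp only [mul_sum]
    refine sum_congr rfl fun s _ => sum_congr rfl fun t _ => ?_
    split_ifs <;> ring
  have hstep2 : ∑ R ∈ tr, (idealDivisorCount R : ℝ) ^ A * (3 * X / Ideal.absNorm R +
        Q⁻¹ * ∑ s ∈ Fq, ∑ t ∈ Iq, (if R ∣ J s t then (1 : ℝ) else 0) * (W s * W' t)) =
      3 * X * ∑ R ∈ tr, (idealDivisorCount R : ℝ) ^ A / Ideal.absNorm R +
        Q⁻¹ * ∑ s ∈ Fq, ∑ t ∈ Iq, W s * W' t *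
          ∑ R ∈ tr.filter (· ∣ J s t), (idealDivisorCount R : ℝ) ^ A := by
    have hre : ∑ R ∈ tr, (idealDivisorCount R : ℝ) ^ A * (3 * X / Ideal.absNorm R +
        Q⁻¹ * ∑ s ∈ Fq, ∑ t ∈ Iq, (if R ∣ J s t then (1 : ℝ) else 0) * (W s * W' t)) =
        ∑ R ∈ tr, (3 * X * ((idealDivisorCount R : ℝ) ^ A / Ideal.absNorm R) +
          Q⁻¹ * ∑ s ∈ Fq, ∑ t ∈ Iq, W s * W' t *
            (if R ∣ J s t then (idealDivisorCount R : ℝ) ^ A else 0)) :=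
      sum_congr rfl fun R hR => by rw [mul_add, hswap R hR]; ring
    rw [hre, sum_add_distrib, ← mul_sum, ← mul_sum]
    congr 1
    congr 1
    rw [sum_comm]
    refine sum_congr rfl fun s _ => ?_
    rw [sum_comm]
    refine sum_congr rfl fun t _ => ?_
    rw [← mul_sum, sum_filter]
  -- Step 3: the divisor bound `∑_{R ∣ J} τ(R)^A ≤ τ(J)^{A+1}`
  have hJ0 : ∀ s t : ℤ, s ≠ 0 → J s t ≠ ⊥ := by
    intro s t hs h0
    rw [hJ, Ideal.span_singleton_eq_bot] at h0
    have h1 := congr_arg (algebraMap (𝓞 K) K) h0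
    simp only [map_sub, map_mul, map_intCast, map_zero, show algebraMap (𝓞 K) K θint = θ from rfl] at h1
    have h2 : ((t : ℤ) : K) + ((-s : ℤ) : K) * θ + ((0 : ℤ) : K) * θ ^ 2 = 0 := by
      push_cast; linear_combination h1
    exact hs (neg_eq_zero.mp (intCoords_eq_zero h2).2.1)
  have hstep3 : ∀ s ∈ Fq, ∀ t ∈ Iq, W s * W' t * ∑ R ∈ tr.filter (· ∣ J s t), (idealDivisorCount R : ℝ) ^ A ≤
      W s * W' t * (idealDivisorCount (J s t) : ℝ) ^ (A + 1) := by
    intro s hs t _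
    have hs0 : s ≠ 0 := (mem_filter.mp hs).2
    exact mul_le_mul_of_nonneg_left (sum_filter_dvd_pow_le tr (hJ0 s t hs0) A)
      (mul_nonneg (hW0 s) (hW'0 t))
  -- Step 4: split `t = 0` / `t ≠ 0`
  have h0mem : (0 : ℤ) ∈ Iq := by rw [hIq, mem_Icc]; omega
  have hW'zero : W' 0 = 2 * X := by simp [hW']
  have hsplit : ∀ s : ℤ, ∑ t ∈ Iq, W s * W' t * (idealDivisorCount (J s t) : ℝ) ^ (A + 1) =
      W s * (2 * X) * (idealDivisorCount (J s 0) : ℝ) ^ (A + 1) +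
        ∑ t ∈ Fq, W s * W' t * (idealDivisorCount (J s t) : ℝ) ^ (A + 1) := by
    intro s
    rw [hFq, Finset.filter_ne', ← Finset.sum_erase_add _ _ h0mem, hW'zero, add_comm]
  -- the `t = 0` terms
  have ht0 : ∑ s ∈ Fq, W s * (2 * X) * (idealDivisorCount (J s 0) : ℝ) ^ (A + 1) ≤
      8 * T₀ ^ (A + 1) * C₄ * Q * X * L ^ (k₄ : ℝ) := by
    have hterm : ∀ s ∈ Fq, W s * (2 * X) * (idealDivisorCount (J s 0) : ℝ) ^ (A + 1) ≤
        4 * Q * X * T₀ ^ (A + 1) * ((σ 0 s.natAbs : ℝ) ^ (12 * (A + 1)) / s.natAbs) := by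
      intro s hs
      have hs0 : s ≠ 0 := (mem_filter.mp hs).2
      have hsabs : (0 : ℝ) < |(s : ℝ)| := abs_pos.mpr (by exact_mod_cast hs0)
      have hτ : (idealDivisorCount (J s 0) : ℝ) ≤ T₀ * (σ 0 s.natAbs : ℝ) ^ 12 := by
        have h := idealDivisorCount_span_mul_θint_le hs0
        have : J s 0 = Ideal.span {((0 : ℤ) : 𝓞 K) - (s : 𝓞 K) * θint} := by simp [hJ]
        rw [this, hT₀]; exact_mod_cast h
      have hnat : (s.natAbs : ℝ) = |(s : ℝ)| := by rw [Nat.cast_natAbs, Int.cast_abs]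
      have a1 : W s * (2 * X) ≤ 2 * Q / |(s : ℝ)| * (2 * X) :=
        mul_le_mul_of_nonneg_right (hWle s hs0) (by linarith only [hX0])
      have a2 : (idealDivisorCount (J s 0) : ℝ) ^ (A + 1) ≤ (T₀ * (σ 0 s.natAbs : ℝ) ^ 12) ^ (A + 1) :=
        pow_le_pow_left₀ (Nat.cast_nonneg _) hτ _
      have a0 : 0 ≤ W s * (2 * X) := mul_nonneg (hW0 s) (by linarith only [hX0])
      have a3 := mul_le_mul a1 a2 (by positivity) (a0.trans a1)
      refine a3.trans (le_of_eq ?_)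
      rw [hnat, mul_pow, ← pow_mul]
      field_simp
      ring
    refine (sum_le_sum hterm).trans ?_
    rw [← mul_sum]
    have hfold : ∑ s ∈ Fq, (σ 0 s.natAbs : ℝ) ^ (12 * (A + 1)) / s.natAbs ≤
        2 * ∑ d ∈ Icc 1 q, (σ 0 d : ℝ) ^ (12 * (A + 1)) / d :=
      sum_filter_ne_zero_natAbs_le q (fun d => (σ 0 d : ℝ) ^ (12 * (A + 1)) / d)
    have hdiv : ∑ d ∈ Icc 1 q, (σ 0 d : ℝ) ^ (12 * (A + 1)) / d ≤ C₄ * L ^ (k₄ : ℝ) := by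
      have hsub : Icc 1 q ⊆ Icc 1 ⌊(q : ℝ) + 2⌋₊ := by
        intro d hd; rw [mem_Icc] at hd ⊢
        refine ⟨hd.1, hd.2.trans (Nat.le_floor ?_)⟩; linarith only
      calc ∑ d ∈ Icc 1 q, (σ 0 d : ℝ) ^ (12 * (A + 1)) / d
          ≤ ∑ d ∈ Icc 1 ⌊(q : ℝ) + 2⌋₊, (σ 0 d : ℝ) ^ (12 * (A + 1)) / d :=
            sum_le_sum_of_subset_of_nonneg hsub fun d _ _ => by positivity
        _ ≤ C₄ * Real.log ((q : ℝ) + 2) ^ k₄ := H4div _ (by linarith only [(q.cast_nonneg : (0:ℝ) ≤ q)])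
        _ ≤ C₄ * L ^ (k₄ : ℝ) := by
            rw [Real.rpow_natCast]
            exact mul_le_mul_of_nonneg_left (pow_le_pow_left₀ hlogq0.le hlogq k₄) hC₄.le
    calc 4 * Q * X * T₀ ^ (A + 1) * ∑ s ∈ Fq, (σ 0 s.natAbs : ℝ) ^ (12 * (A + 1)) / s.natAbs
        ≤ 4 * Q * X * T₀ ^ (A + 1) * (2 * (C₄ * L ^ (k₄ : ℝ))) := by
          refine mul_le_mul_of_nonneg_left (hfold.trans ?_) (by positivity)
          linarith only [hdiv]
      _ = 8 * T₀ ^ (A + 1) * C₄ * Q * X * L ^ (k₄ : ℝ) := by ring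
  -- the `t ≠ 0` terms
  have ht1 : ∑ s ∈ Fq, ∑ t ∈ Fq, W s * W' t * (idealDivisorCount (J s t) : ℝ) ^ (A + 1) ≤
      4 * Q ^ 2 * (16 * C₂ * 4 ^ c₂ * (Real.log 2)⁻¹ ^ 2) * L ^ e₂ := by
    have hterm : ∀ s ∈ Fq, ∀ t ∈ Fq, W s * W' t * (idealDivisorCount (J s t) : ℝ) ^ (A + 1) ≤
        4 * Q ^ 2 * ((idealDivisorCount (J s t) : ℝ) ^ (A + 1) / (|(s : ℝ)| * |(t : ℝ)|)) := by
      intro s hs t ht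
      have hs0 : s ≠ 0 := (mem_filter.mp hs).2
      have ht0 : t ≠ 0 := (mem_filter.mp ht).2
      have hsabs : (0 : ℝ) < |(s : ℝ)| := abs_pos.mpr (by exact_mod_cast hs0)
      have htabs : (0 : ℝ) < |(t : ℝ)| := abs_pos.mpr (by exact_mod_cast ht0)
      have hW't : W' t ≤ 2 * Q / |(t : ℝ)| := by
        show (if t = 0 then 2 * X else min (2 * X) (2 * Q / |(t : ℝ)|)) ≤ _
        rw [if_neg ht0]; exact min_le_right _ _
      have hQs : 0 ≤ 2 * Q / |(s : ℝ)| := by positivity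
      calc W s * W' t * (idealDivisorCount (J s t) : ℝ) ^ (A + 1)
          ≤ (2 * Q / |(s : ℝ)|) * (2 * Q / |(t : ℝ)|) * (idealDivisorCount (J s t) : ℝ) ^ (A + 1) :=
            mul_le_mul_of_nonneg_right (mul_le_mul (hWle s hs0) hW't (hW'0 t) hQs) (by positivity)
        _ = 4 * Q ^ 2 * ((idealDivisorCount (J s t) : ℝ) ^ (A + 1) / (|(s : ℝ)| * |(t : ℝ)|)) := by
            rw [div_mul_div_comm, show 2 * Q * (2 * Q) = 4 * Q ^ 2 by ring, div_mul_eq_mul_div,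
              mul_div_assoc]
    calc ∑ s ∈ Fq, ∑ t ∈ Fq, W s * W' t * (idealDivisorCount (J s t) : ℝ) ^ (A + 1)
        ≤ ∑ s ∈ Fq, ∑ t ∈ Fq, 4 * Q ^ 2 * ((idealDivisorCount (J s t) : ℝ) ^ (A + 1) / (|(s : ℝ)| * |(t : ℝ)|)) :=
          sum_le_sum fun s hs => sum_le_sum fun t ht => hterm s hs t ht
      _ = 4 * Q ^ 2 * ∑ s ∈ Fq, ∑ t ∈ Fq, (idealDivisorCount (J s t) : ℝ) ^ (A + 1) / (|(s : ℝ)| * |(t : ℝ)|) := by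
          rw [mul_sum]; refine sum_congr rfl fun s _ => ?_; rw [mul_sum]
      _ ≤ 4 * Q ^ 2 * (16 * C₂ * 4 ^ c₂ * (Real.log 2)⁻¹ ^ 2 * Real.log (q + 2) ^ (c₂ + 2)) :=
          mul_le_mul_of_nonneg_left (sum_sum_div_abs_le_of_lemma_4_7 hc₂ hC₂ H47 q) (by positivity)
      _ ≤ 4 * Q ^ 2 * (16 * C₂ * 4 ^ c₂ * (Real.log 2)⁻¹ ^ 2 * L ^ e₂) := by
          refine mul_le_mul_of_nonneg_left (mul_le_mul_of_nonneg_left ?_ (by positivity)) (by positivity)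
          rw [he₂]; exact Real.rpow_le_rpow hlogq0.le hlogq he₂0
      _ = _ := by ring
  -- Step 5: combine
  have hpow : ∀ {e : ℝ}, 0 ≤ e → e ≤ cfin → L ^ e ≤ M * L ^ cfin := fun he hec =>
    rpow_le_inv_log_two_pow_mul hL2 he hec
  have hP0 : 0 ≤ X + Q := by linarith only [hX0, hQ]
  calc ∑ R ∈ tr, (idealDivisorCount R : ℝ) ^ A * |(latticeCount X η R : ℝ) - η ^ 2 * X ^ 2 / Ideal.absNorm R|
      ≤ ∑ R ∈ tr, (idealDivisorCount R : ℝ) ^ A * (3 * X / Ideal.absNorm R +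
          Q⁻¹ * ∑ s ∈ Fq, ∑ t ∈ Iq, (if R ∣ J s t then (1 : ℝ) else 0) * (W s * W' t)) :=
        sum_le_sum hstep1
    _ = _ := hstep2
    _ ≤ 3 * X * (D₁ * L ^ (k₁ : ℝ)) + Q⁻¹ * ∑ s ∈ Fq, (W s * (2 * X) * (idealDivisorCount (J s 0) : ℝ) ^ (A + 1) +
          ∑ t ∈ Fq, W s * W' t * (idealDivisorCount (J s t) : ℝ) ^ (A + 1)) := by
        refine add_le_add ?_ ?_
        · refine mul_le_mul_of_nonneg_left ?_ (by positivity)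
          rw [Real.rpow_natCast]; exact hmain
        · refine mul_le_mul_of_nonneg_left (sum_le_sum fun s hs => ?_) (by positivity)
          rw [← hsplit s]
          exact sum_le_sum fun t ht => hstep3 s hs t ht
    _ = 3 * D₁ * X * L ^ (k₁ : ℝ) + Q⁻¹ * (∑ s ∈ Fq, W s * (2 * X) * (idealDivisorCount (J s 0) : ℝ) ^ (A + 1) +
          ∑ s ∈ Fq, ∑ t ∈ Fq, W s * W' t * (idealDivisorCount (J s t) : ℝ) ^ (A + 1)) := by
        rw [sum_add_distrib]; ring
    _ ≤ 3 * D₁ * X * L ^ (k₁ : ℝ) + Q⁻¹ * (8 * T₀ ^ (A + 1) * C₄ * Q * X * L ^ (k₄ : ℝ) +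
          4 * Q ^ 2 * (16 * C₂ * 4 ^ c₂ * (Real.log 2)⁻¹ ^ 2) * L ^ e₂) :=
        add_le_add le_rfl (mul_le_mul_of_nonneg_left (add_le_add ht0 ht1) (by positivity))
    _ = K₁ * X * L ^ (k₁ : ℝ) + K₃ * X * L ^ (k₄ : ℝ) + K₂ * Q * L ^ e₂ := by
        rw [hK₁, hK₂, hK₃]; field_simp; ring
    _ ≤ K₁ * X * (M * L ^ cfin) + K₃ * X * (M * L ^ cfin) + K₂ * Q * (M * L ^ cfin) := by
        refine add_le_add (add_le_add ?_ ?_) ?_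
        · exact mul_le_mul_of_nonneg_left (hpow hk₁0 he₁c) (by positivity)
        · exact mul_le_mul_of_nonneg_left (hpow hk₄0 he₃c) (by positivity)
        · exact mul_le_mul_of_nonneg_left (hpow he₂0 he₂c) (by positivity)
    _ ≤ (K₁ + K₂ + K₃) * M * (X + Q) * L ^ cfin := by
        have hLc : 0 ≤ M * L ^ cfin := by positivity
        have h1 : K₁ * X ≤ K₁ * (X + Q) := mul_le_mul_of_nonneg_left (by linarith only [hQ]) hK₁0
        have h2 : K₃ * X ≤ K₃ * (X + Q) := mul_le_mul_of_nonneg_left (by linarith only [hQ]) hK₃0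
        have h3 : K₂ * Q ≤ K₂ * (X + Q) := mul_le_mul_of_nonneg_left (by linarith only [hX0]) hK₂0
        calc K₁ * X * (M * L ^ cfin) + K₃ * X * (M * L ^ cfin) + K₂ * Q * (M * L ^ cfin)
            = (K₁ * X + K₃ * X + K₂ * Q) * (M * L ^ cfin) := by ring
          _ ≤ ((K₁ + K₂ + K₃) * (X + Q)) * (M * L ^ cfin) :=
              mul_le_mul_of_nonneg_right (by linarith only [h1, h2, h3]) hLc
          _ = _ := by ring

/-- **Lemma 3.2 from Lemma 4.7 alone**: combining `HeathBrown2001_typeI_A_of_bounds`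
(`HeathBrownCubicTypeIProofs`) with `lemma_5_1_bound_of_lemma_4_7_bound`, the Type I bound
`HeathBrown2001_typeI_A` follows from the estimate of Lemma 4.7. [cite: HeathBrownActa2001, Lemma 3.2] -/
theorem HeathBrown2001_typeI_A_of_lemma_4_7
    (h47 : ∀ A : ℕ, 0 < A → ∃ c C : ℝ, 0 ≤ c ∧ 0 ≤ C ∧ ∀ x y : ℝ, 2 ≤ x → 2 ≤ y →
      ∑ m ∈ (Icc (-⌊x⌋) ⌊x⌋).filter (· ≠ 0), ∑ n ∈ (Icc (-⌊y⌋) ⌊y⌋).filter (· ≠ 0),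
        (idealDivisorCount (Ideal.span {((m : ℤ) : 𝓞 K) + ((n : ℤ) : 𝓞 K) * θint}) : ℝ) ^ A ≤
      C * x * y * Real.log (x * y) ^ c) :
    HeathBrown2001_typeI_A :=
  HeathBrown2001_typeI_A_of_bounds h47 (lemma_5_1_bound_of_lemma_4_7_bound h47)

end Literature.NumberTheory.Sieve.CubicSieve

end
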